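import Literature.NumberTheory.Sieve.BombieriFriedlanderIwaniecTheorem1R1
import Literature.NumberTheory.Sieve.BombieriFriedlanderIwaniecTheorem5StarFromTheorem5
import Literature.NumberTheory.Sieve.BombieriFriedlanderIwaniecLemma6Counting
import HarnessLib

/-!
# Bombieri–Friedlander–Iwaniec 1986: Lemma 6 from Lemma 1, hence Theorems 5, 5* from Lemma 1

Topic `Literature/NumberTheory/Sieve`.  Everything here is PROVED; no named fact is introduced.
E. Bombieri, J. B. Friedlander, H. Iwaniec, *Primes in arithmetic progressions to large moduli*,
Acta Math. 156 (1986), 203–251, prove their Lemma 6 (§8, (8.4), p. 227) — the bound for the sum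
`𝒜(C, D, K, H, Q)` of (8.2)–(8.3) (`BFI.dispA`, `…Theorem5Reciprocity`) on which both Theorem 1
(§8, via (8.2), cf. `…Theorem1R1`) and Theorem 5 (§12, via Lemma 9, cf.
`BombieriFriedlanderIwaniecTheorem5_of_lemma6`) rest — in half a page from their Lemma 1 (§2,
p. 210), which is Deshouillers–Iwaniec, Invent. Math. 70 (1982), Theorem 12 (Kuznetsov's formula
and the spectral theory of `Γ₀(rs)∖ℍ`; in neither Mathlib nor the tree).  This file formalises
that half page, so that the named facts `BombieriFriedlanderIwaniecTheorem5`,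
`BombieriFriedlanderIwaniecTheorem5Star` and `BombieriFriedlanderIwaniecTheorem5StarInterval` are
now conditional on Lemma 1 alone (`BombieriFriedlanderIwaniecTheorem5_of_lemma1`,
`…Theorem5Star_of_lemma1`, `…Theorem5StarInterval_of_lemma1`).

## Lemma 1 as a hypothesis

* `BFI.dispK g cM dM N R S B` — the sum `𝓚(C,D,N,R,S)` of Lemma 1 for a discretised weight
  `g(c,d)` (cut at `cM, dM`, beyond the support), `BFI.lemma1I` (`𝓘`), `BFI.lemma1Norm` (`‖B‖`).
* `BFI.Lemma1BoundFor g₀ b` — the printed bound "`𝓚 ≪_{ε,g} (CDNRS)^ε 𝓘 ‖B‖`" for ONE weight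
  `g(c,d) = g₀(c/C, d/D)` with `g₀` supported in `(0, b]²`, in the ranges `C, D, N ≥ 1`,
  `R, S ≥ 1/2` (a sub-range of the printed `C, D, N, R, S > 0`); a predicate in `(g₀, b)`, used
  only as a hypothesis.  The proof of Lemma 6 needs it for the single weight `w ⊗ w`
  (`BFI.plateau2`, `w = BFI.bump (1/2) (1/4)`: smooth, `= 1` on `[1/2,1]`, supported in
  `[1/4,5/4]`), i.e. the hypothesis `BFI.Lemma1BoundFor BFI.plateau2 (5/4)`; the form quantified
  over all smooth `g₀` with compact support in `ℝ⁺ × ℝ⁺` (as printed) feeds it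
  (`BombieriFriedlanderIwaniecTheorem5_of_lemma1'`).

## The proof of Lemma 6 (BFI p. 227), namespace `BFI.L6`

1. "Clearly, it suffices to prove (8.4) for a modified sum having the variables `c, d` reduced by
   a smooth weight function `g(c, d)`": the sharp ranges `c ≤ C`, `d ≤ D` are majorised (all terms
   of `𝒜` being `≥ 0`) by the `O(log C log D)` smooth dyadic plateaus `w(c/2^i) w(d/2^j)`
   (`one_le_sum_plateau`, `dispA_le_sum_blockA`).
2. "Squaring and changing the order of summation": `blockA = Z = ∑_{t=(k,h₁,q₁,h₂,q₂)} w_t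
   Inner(ak(h₁q₂−h₂q₁), q₁q₂)` (`blockA_eq_Zsum`), the phases combining by
   `h₁ a(dq₁)‾ − h₂ a(dq₂)‾ ≡ a(h₁q₂ − h₂q₁)(q₁q₂d)‾ (mod c)` (`phase_mul_conj`), so that the
   Kloosterman fraction `e(n (rd)‾/c)` of `𝓚` appears with `n = ak(h₁q₂−h₂q₁)`, `r = q₁q₂`,
   `s = 1`.
3. The terms are split by the sign of `m = h₁q₂ − h₂q₁`; `m < 0` is the complex conjugate of
   `m > 0` (`Zpart_neg_eq_conj`), so `blockA ≤ |Z₀| + 2|Z₊|` (`blockA_le_parts`).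
4. "The terms on the diagonal (`n = 0`) … contribute trivially `≪ CDHKQ (log 2HQ)⁴`":
   `|Z₀| ≤ ♯T₀ ∑ g` with `♯T₀ = K ∑_{q₁,q₂} ♯{h₁q₂ = h₂q₁} ≤ 2KH ∑_{q≤Q} τ(q)`
   (`norm_Zpart_zero_le`, `card_tsetZero`, and `BFI.sum_card_diagPairs_le` of `…Lemma6Counting`).
5. "The terms off the diagonal (`n ≠ 0`), by Lemma 1": `Z₊ = ∑_{(n,r)} B(n,r) Inner(n,r)` with
   `B(n,r) = ∑_{q₁q₂=r} ∑_{ak(h₁q₂−h₂q₁)=n} α(h₁,q₁)ᾱ(h₂,q₂)` (`Zpart_pos_eq_sum_Bcoef`); the range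
   `r ≤ Q²` is cut into dyadic blocks `r ∼ 2^l/2`, on each of which `Z₊` IS a sum `𝓚` at
   `S = 1/2` (`Zpart_pos_eq_sum_dispK`, `dispK_half_eq`), bounded by the hypothesis.
6. "`‖B‖² ≪ (HKQ)^ε K ♯{q₁,q₂,h₁,h₂,h₃,h₄ : (h₁−h₃)q₂ = (h₂−h₄)q₁} ≪ (HKQ)^ε K(H²Q² + H³Q)`":
   Cauchy–Schwarz over the `≤ τ(n)τ(r)` pairs `(k, q₁)` contributing to `B(n,r)` and the count
   `ν(l;q₁,q₂) ≤ H(q₁,q₂)/max(q₁,q₂) + 1` of `…Lemma6Counting` (`sum_norm_sq_Bcoef_le`).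
7. "Gathering the above results together we obtain (8.4)": `blockA_le_of_K1`, the elementary
   size estimates `lemma1I_le`, `eps_factor_le`, `boxsum_le`, `diag_term_le`,
   `natLog_two_add_two_le` (all logarithms absorbed into `(CDHKQ)^η`, the divisor function by the
   divisor bound of `DivisorBound`), and `dispA_le_pos` (`a > 0`); `a < 0` is reduced to `a > 0` by
   `𝒜(−a; α) = 𝒜(a; ᾱ)` (`dispA_neg`).  `BFI.L6.dispA_le_of_lemma1` is Lemma 6 in exactly the
   shape of the hypothesis `h6` of `BombieriFriedlanderIwaniecTheorem5_of_lemma6`.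

## References

* E. Bombieri, J. B. Friedlander, H. Iwaniec, Acta Math. 156 (1986), 203–251: §2 Lemma 1 p. 210;
  §8 (8.2)–(8.4), Lemma 6 and its proof, pp. 226–227; §12 Theorem 5 p. 237, Theorem 5* p. 238.
  [BombieriFriedlanderIwaniecActa1986]
* J.-M. Deshouillers, H. Iwaniec, *Kloosterman sums and Fourier coefficients of cusp forms*,
  Invent. Math. 70 (1982), 219–288, Theorem 12 (BFI's reference [2]).
-/

noncomputable section

open Finset Real
open scoped ArithmeticFunction.sigma ContDiff FourierTransform ComplexConjugate

namespace Literature.NumberTheory.Sieve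

namespace BFI

/-! ### Lemma 1: the sum `𝓚`, the quantity `𝓘`, the norm `‖B‖` -/

/-- **BFI's sum `𝓚(C, D, N, R, S)` of Lemma 1** (§2, p. 210 = Deshouillers–Iwaniec, Invent. Math.
70 (1982), Theorem 12): `𝓚 = ∑_{r∼R} ∑_{s∼S} ∑_{0<n≤N} B_{nrs} ∑_c ∑_d_{(rd,sc)=1} g(c,d) e(n (rd)‾/(sc))`
where `(rd)‾ · rd ≡ 1 (mod sc)`.  Here `g` is already the discretised weight `g(c,d)` and the sums
over `c, d ≥ 1` are cut at `cM, dM` (in Lemma 1, `g(c,d) = g₀(c/C, d/D)` with `g₀` of compact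
support in `ℝ⁺ × ℝ⁺`, so the sums are finite; the cut-offs are chosen beyond the support); the
phase is written `e(n · ((rd)⁻¹ mod sc)/(sc))`.
[cite: BombieriFriedlanderIwaniecActa1986, §2 Lemma 1 p. 210] -/
def dispK (g : ℕ → ℕ → ℝ) (cM dM N : ℕ) (R S : ℝ) (B : ℕ → ℕ → ℕ → ℂ) : ℂ :=
  ∑ r ∈ dyadic R, ∑ s ∈ dyadic S, ∑ n ∈ Finset.Icc 1 N, B n r s *
    ∑ c ∈ Finset.Icc 1 cM, ∑ d ∈ (Finset.Icc 1 dM).filter (fun d => (r * d).Coprime (s * c)),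
      ((g c d : ℝ) : ℂ) *
        (𝐞 ((n : ℝ) * (((((r * d : ℕ) : ZMod (s * c)))⁻¹.val : ℕ) : ℝ) / ((s * c : ℕ) : ℝ)) : ℂ)

/-- **The quantity `𝓘(C, D, N, R, S)` of Lemma 1** (p. 210):
`𝓘² = CS(RS + N)(C + DR) + C²DS √((RS + N)R) + D²NRS⁻¹`.
[cite: BombieriFriedlanderIwaniecActa1986, §2 Lemma 1 p. 210] -/
def lemma1I (C D N R S : ℝ) : ℝ :=
  Real.sqrt (C * S * (R * S + N) * (C + D * R) + C ^ 2 * D * S * Real.sqrt ((R * S + N) * R) +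
    D ^ 2 * N * R / S)

/-- **The norm `‖B‖` of Lemma 1** (p. 210): `‖B‖² = ∑_{r∼R} ∑_{s∼S} ∑_{0<n≤N} |B_{nrs}|²`.
[cite: BombieriFriedlanderIwaniecActa1986, §2 Lemma 1 p. 210] -/
def lemma1Norm (N : ℕ) (R S : ℝ) (B : ℕ → ℕ → ℕ → ℂ) : ℝ :=
  Real.sqrt (∑ r ∈ dyadic R, ∑ s ∈ dyadic S, ∑ n ∈ Finset.Icc 1 N, ‖B n r s‖ ^ 2)

/-- **The bound of Lemma 1 for a given weight** `g₀(ξ, η)` supported in `(0, b]²` (p. 210: "for any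
`ε > 0` we have `𝓚(C,D,N,R,S) ≪ (CDNRS)^ε 𝓘(C,D,N,R,S) ‖B‖`, the constant implied in `≪` depending
at most on `ε` and `g(ξ, η)`"), with `g(c, d) = g₀(c/C, d/D)` and the sums over `c, d` cut at
`bC, bD` (beyond the support), in the ranges `C, D, N ≥ 1`, `R, S ≥ 1/2` (a sub-range of the
printed `C, D, N, R, S > 0`).  A predicate in `(g₀, b)`, used as a HYPOTHESIS below; BFI quote it
from Deshouillers–Iwaniec, Invent. Math. 70 (1982), Theorem 12 (Kuznetsov's formula), which is not
in Mathlib or the tree. [cite: BombieriFriedlanderIwaniecActa1986, §2 Lemma 1 p. 210] -/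
def Lemma1BoundFor (g₀ : ℝ → ℝ → ℝ) (b : ℝ) : Prop :=
  ∀ ε : ℝ, 0 < ε → ∃ K : ℝ, ∀ C D N R S : ℝ, 1 ≤ C → 1 ≤ D → 1 ≤ N → 1 / 2 ≤ R → 1 / 2 ≤ S →
    ∀ B : ℕ → ℕ → ℕ → ℂ,
      ‖dispK (fun c d => g₀ (c / C) (d / D)) ⌊b * C⌋₊ ⌊b * D⌋₊ ⌊N⌋₊ R S B‖ ≤
        K * (C * D * N * R * S) ^ ε * lemma1I C D N R S * lemma1Norm ⌊N⌋₊ R S B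

/-! ### The smooth plateau weight -/

/-- The one-variable plateau `w = BFI.bump (1/2) (1/4)`: smooth, `0 ≤ w ≤ 1`, `w = 1` on `[1/2, 1]`,
`w = 0` outside `(1/4, 5/4)`. [folklore] -/
def plateau1 (u : ℝ) : ℝ := bump (1 / 2) (1 / 4) u

/-- The two-variable weight `g₀(ξ, η) = w(ξ) w(η)` used for Lemma 1. [folklore] -/
def plateau2 (ξ η : ℝ) : ℝ := plateau1 ξ * plateau1 η

/-- `w = 1` on `[1/2, 1]`. [folklore] -/
theorem plateau_eq_one {u : ℝ} (h1 : 1 / 2 ≤ u) (h2 : u ≤ 1) : plateau1 u = 1 :=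
  bump_eq_one (by norm_num) h1 (by linarith)

/-- `w = 0` to the left of `1/4`. [folklore] -/
theorem plateau_eq_zero_of_le {u : ℝ} (h : u ≤ 1 / 4) : plateau1 u = 0 :=
  bump_eq_zero_of_le (by norm_num) (by norm_num) (by linarith)

/-- `w = 0` to the right of `5/4`. [folklore] -/
theorem plateau_eq_zero_of_ge {u : ℝ} (h : 5 / 4 ≤ u) : plateau1 u = 0 :=
  bump_eq_zero_of_ge (by norm_num) (by norm_num) (by linarith)

/-- `0 ≤ w`. [folklore] -/
theorem plateau_nonneg (u : ℝ) : 0 ≤ plateau1 u :=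
  (bump_mem_Icc (by norm_num) (by norm_num) u).1

/-- `w ≤ 1`. [folklore] -/
theorem plateau_le_one (u : ℝ) : plateau1 u ≤ 1 :=
  (bump_mem_Icc (by norm_num) (by norm_num) u).2

/-- `w` is smooth. [folklore] -/
theorem contDiff_plateau : ContDiff ℝ ∞ plateau1 := contDiff_bump _ _

/-- `0 ≤ g₀`. [folklore] -/
theorem plateau2_nonneg (ξ η : ℝ) : 0 ≤ plateau2 ξ η :=
  mul_nonneg (plateau_nonneg ξ) (plateau_nonneg η)

/-- `g₀ ≤ 1`. [folklore] -/
theorem plateau2_le_one (ξ η : ℝ) : plateau2 ξ η ≤ 1 :=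
  mul_le_one₀ (plateau_le_one ξ) (plateau_nonneg η) (plateau_le_one η)

/-- `g₀` is smooth on `ℝ²`. [folklore] -/
theorem contDiff_plateau2 : ContDiff ℝ ∞ (fun p : ℝ × ℝ => plateau2 p.1 p.2) :=
  (contDiff_plateau.comp contDiff_fst).mul (contDiff_plateau.comp contDiff_snd)

/-- `g₀` is supported in `[1/4, 5/4]²`. [folklore] -/
theorem plateau2_eq_zero {ξ η : ℝ} (h : ¬ (ξ ∈ Set.Icc (1 / 4 : ℝ) (5 / 4) ∧ η ∈ Set.Icc (1 / 4 : ℝ) (5 / 4))) :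
    plateau2 ξ η = 0 := by
  unfold plateau2
  simp only [Set.mem_Icc, not_and_or, not_le] at h
  rcases h with (h | h) | (h | h)
  · rw [plateau_eq_zero_of_le h.le, zero_mul]
  · rw [plateau_eq_zero_of_ge h.le, zero_mul]
  · rw [plateau_eq_zero_of_le h.le, mul_zero]
  · rw [plateau_eq_zero_of_ge h.le, mul_zero]

/-- `g₀ = 1` on `[1/2, 1]²`. [folklore] -/
theorem plateau2_eq_one {ξ η : ℝ} (h1 : 1 / 2 ≤ ξ) (h2 : ξ ≤ 1) (h3 : 1 / 2 ≤ η) (h4 : η ≤ 1) :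
    plateau2 ξ η = 1 := by
  rw [plateau2, plateau_eq_one h1 h2, plateau_eq_one h3 h4, mul_one]

/-! ### The index set of the expanded square and the Kloosterman phase -/

namespace L6

/-- Index pairs `((h₁, q₁), (h₂, q₂))` with `1 ≤ hᵢ ≤ H`, `1 ≤ qᵢ ≤ Q`. [folklore] -/
def pairs (H Q : ℕ) : Finset ((ℕ × ℕ) × (ℕ × ℕ)) :=
  (Finset.Icc 1 H ×ˢ Finset.Icc 1 Q) ×ˢ (Finset.Icc 1 H ×ˢ Finset.Icc 1 Q)

/-- `m = h₁ q₂ − h₂ q₁`. [folklore] -/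
def mval (p : (ℕ × ℕ) × (ℕ × ℕ)) : ℤ := (p.1.1 : ℤ) * p.2.2 - (p.2.1 : ℤ) * p.1.2

/-- `r = q₁ q₂`. [folklore] -/
def rval (p : (ℕ × ℕ) × (ℕ × ℕ)) : ℕ := p.1.2 * p.2.2

/-- The weight `α(h₁,q₁) conj α(h₂,q₂)`. [folklore] -/
def wt (α : ℕ → ℕ → ℂ) (p : (ℕ × ℕ) × (ℕ × ℕ)) : ℂ := α p.1.1 p.1.2 * conj (α p.2.1 p.2.2)

/-- The swap `((h₁,q₁),(h₂,q₂)) ↦ ((h₂,q₂),(h₁,q₁))`. [folklore] -/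
theorem mval_swap (p : (ℕ × ℕ) × (ℕ × ℕ)) : mval p.swap = -mval p := by
  unfold mval; simp only [Prod.fst_swap, Prod.snd_swap]; ring

/-- `r` is invariant under the swap. [folklore] -/
theorem rval_swap (p : (ℕ × ℕ) × (ℕ × ℕ)) : rval p.swap = rval p := by
  unfold rval; simp only [Prod.fst_swap, Prod.snd_swap]; ring

/-- The weight of the swapped pair is the complex conjugate. [folklore] -/
theorem wt_swap (α : ℕ → ℕ → ℂ) (p : (ℕ × ℕ) × (ℕ × ℕ)) : wt α p.swap = conj (wt α p) := by
  unfold wt; simp only [Prod.fst_swap, Prod.snd_swap, map_mul, Complex.conj_conj]; ring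

/-- The swap preserves the index box. [folklore] -/
theorem swap_mem_pairs {H Q : ℕ} {p : (ℕ × ℕ) × (ℕ × ℕ)} (hp : p ∈ pairs H Q) : p.swap ∈ pairs H Q := by
  simp only [pairs, Finset.mem_product] at hp ⊢
  exact ⟨hp.2, hp.1⟩

/-- `|w_t| ≤ 1` when `|α| ≤ 1`. [folklore] -/
theorem norm_wt_le {α : ℕ → ℕ → ℂ} (hα : ∀ h q, ‖α h q‖ ≤ 1) (p : (ℕ × ℕ) × (ℕ × ℕ)) :
    ‖wt α p‖ ≤ 1 := by
  unfold wt
  rw [norm_mul, Complex.norm_conj]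
  exact mul_le_one₀ (hα _ _) (norm_nonneg _) (hα _ _)

/-- The Kloosterman-fraction phase `e(n · x̄/c)`, `x̄ x ≡ 1 (mod c)`. [folklore] -/
def eInv (c x : ℕ) (n : ℤ) : ℂ :=
  (𝐞 ((n : ℝ) * ((((x : ℕ) : ZMod c))⁻¹.val : ℝ) / (c : ℝ)) : ℂ)

/-- `|e(n x̄/c)| = 1`. [folklore] -/
theorem norm_eInv (c x : ℕ) (n : ℤ) : ‖eInv c x n‖ = 1 := by
  unfold eInv; exact Circle.norm_coe _

/-- `e(0 · x̄/c) = 1`. [folklore] -/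
theorem eInv_zero (c x : ℕ) : eInv c x 0 = 1 := by
  unfold eInv; simp

/-- `e(−n x̄/c) = conj e(n x̄/c)`. [folklore] -/
theorem eInv_neg (c x : ℕ) (n : ℤ) : eInv c x (-n) = conj (eInv c x n) := by
  unfold eInv
  rw [← e_neg_eq_conj]
  congr 2
  push_cast
  ring

/-- The sum `∑_c ∑_{d, (rd,c)=1} g(c,d) e(n (rd)‾/c)` (the inner sum of `𝓚` at `s = 1`). [folklore] -/
def inner (g : ℕ → ℕ → ℝ) (cM dM : ℕ) (n : ℤ) (r : ℕ) : ℂ :=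
  ∑ c ∈ Finset.Icc 1 cM, ∑ d ∈ (Finset.Icc 1 dM).filter (fun d => (r * d).Coprime c),
    ((g c d : ℝ) : ℂ) * eInv c (r * d) n

/-- `Inner(−n, r) = conj Inner(n, r)` (the weight `g` is real). [folklore] -/
theorem inner_neg (g : ℕ → ℕ → ℝ) (cM dM : ℕ) (n : ℤ) (r : ℕ) :
    inner g cM dM (-n) r = conj (inner g cM dM n r) := by
  unfold inner
  rw [map_sum]
  refine Finset.sum_congr rfl fun c _ => ?_
  rw [map_sum]
  refine Finset.sum_congr rfl fun d _ => ?_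
  rw [map_mul, Complex.conj_ofReal, eInv_neg]

/-- `|Inner(n, r)| ≤ ∑_{c,d} g(c,d)` for `g ≥ 0`. [folklore] -/
theorem norm_inner_le {g : ℕ → ℕ → ℝ} (hg : ∀ c d, 0 ≤ g c d) (cM dM : ℕ) (n : ℤ) (r : ℕ) :
    ‖inner g cM dM n r‖ ≤ ∑ c ∈ Finset.Icc 1 cM, ∑ d ∈ Finset.Icc 1 dM, g c d := by
  unfold inner
  refine (norm_sum_le _ _).trans (Finset.sum_le_sum fun c _ => ?_)
  refine (norm_sum_le _ _).trans ?_
  calc ∑ d ∈ (Finset.Icc 1 dM).filter (fun d => (r * d).Coprime c), ‖((g c d : ℝ) : ℂ) * eInv c (r * d) n‖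
      = ∑ d ∈ (Finset.Icc 1 dM).filter (fun d => (r * d).Coprime c), g c d := by
        refine Finset.sum_congr rfl fun d _ => ?_
        rw [norm_mul, norm_eInv, mul_one, Complex.norm_real, Real.norm_eq_abs, abs_of_nonneg (hg c d)]
    _ ≤ ∑ d ∈ Finset.Icc 1 dM, g c d :=
        Finset.sum_le_sum_of_subset_of_nonneg (Finset.filter_subset _ _) fun d _ _ => hg c d

/-! ### The phase identity -/

/-- **The phases of the expanded square combine into a Kloosterman fraction**: for `(c, dq₁) =
(c, dq₂) = 1`, `e(h₁k · a(dq₁)‾/c) · conj e(h₂k · a(dq₂)‾/c) = e(ak(h₁q₂ − h₂q₁) · (q₁q₂d)‾/c)`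
(all inverses modulo `c`), since `(dq₁)‾ ≡ q₂ (q₁q₂d)‾`.
[cite: BombieriFriedlanderIwaniecActa1986, §8 p. 227] -/
theorem phase_mul_conj {c : ℕ} (hc : 0 < c) (a : ℤ) {d q₁ q₂ : ℕ} (h1 : c.Coprime (d * q₁))
    (h2 : c.Coprime (d * q₂)) (h₁ h₂ k : ℕ) :
    (𝐞 (((((a : ZMod c) * ((d * q₁ : ℕ) : ZMod c)⁻¹).val : ℕ) : ℝ) * h₁ * k / c) : ℂ) *
      conj ((𝐞 (((((a : ZMod c) * ((d * q₂ : ℕ) : ZMod c)⁻¹).val : ℕ) : ℝ) * h₂ * k / c) : ℂ)) =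
      eInv c (q₁ * q₂ * d) (a * k * ((h₁ : ℤ) * q₂ - (h₂ : ℤ) * q₁)) := by
  haveI : NeZero c := ⟨hc.ne'⟩
  set ρ₁ : ℕ := ((a : ZMod c) * ((d * q₁ : ℕ) : ZMod c)⁻¹).val with hρ₁
  set ρ₂ : ℕ := ((a : ZMod c) * ((d * q₂ : ℕ) : ZMod c)⁻¹).val with hρ₂
  set ι : ℕ := (((q₁ * q₂ * d : ℕ) : ZMod c))⁻¹.val with hι
  -- the congruence `ρ₁ h₁ k − ρ₂ h₂ k ≡ n ι (mod c)`, `n = ak(h₁q₂ − h₂q₁)`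
  have hcong : (c : ℤ) ∣ (ρ₁ : ℤ) * h₁ * k - (ρ₂ : ℤ) * h₂ * k -
      (a * k * ((h₁ : ℤ) * q₂ - (h₂ : ℤ) * q₁)) * ι := by
    rw [← ZMod.intCast_zmod_eq_zero_iff_dvd]
    push_cast
    rw [ZMod.natCast_zmod_val, ZMod.natCast_zmod_val, ZMod.natCast_zmod_val]
    have h3 : c.Coprime (q₁ * q₂ * d) := by
      rw [Nat.coprime_mul_iff_right] at h1 h2
      rw [Nat.coprime_mul_iff_right, Nat.coprime_mul_iff_right]
      exact ⟨⟨h1.2, h2.2⟩, h1.1⟩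
    have hu1 : ((d * q₁ : ℕ) : ZMod c) * ((d * q₁ : ℕ) : ZMod c)⁻¹ = 1 :=
      ZMod.coe_mul_inv_eq_one _ (Nat.coprime_comm.1 h1)
    have hu2 : ((d * q₂ : ℕ) : ZMod c) * ((d * q₂ : ℕ) : ZMod c)⁻¹ = 1 :=
      ZMod.coe_mul_inv_eq_one _ (Nat.coprime_comm.1 h2)
    have hu3 : ((q₁ * q₂ * d : ℕ) : ZMod c) * ((q₁ * q₂ * d : ℕ) : ZMod c)⁻¹ = 1 :=
      ZMod.coe_mul_inv_eq_one _ (Nat.coprime_comm.1 h3)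
    set I₁ := ((d * q₁ : ℕ) : ZMod c)⁻¹
    set I₂ := ((d * q₂ : ℕ) : ZMod c)⁻¹
    set I₃ := ((q₁ * q₂ * d : ℕ) : ZMod c)⁻¹
    push_cast at hu1 hu2 hu3
    set X : ZMod c := (a : ZMod c) * I₁ * h₁ * k - (a : ZMod c) * I₂ * h₂ * k -
      (a : ZMod c) * k * ((h₁ : ZMod c) * q₂ - (h₂ : ZMod c) * q₁) * I₃ with hX
    have hX3 : X * ((q₁ : ZMod c) * q₂ * d * I₃) = 0 := by
      rw [hX]
      linear_combination ((a : ZMod c) * h₁ * k * q₂ * I₃) * hu1 -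
        ((a : ZMod c) * h₂ * k * q₁ * I₃) * hu2 -
        ((a : ZMod c) * k * ((h₁ : ZMod c) * q₂ - (h₂ : ZMod c) * q₁) * I₃) * hu3
    have : X = 0 := by
      calc X = X * ((q₁ : ZMod c) * q₂ * d * I₃) := by rw [hu3, mul_one]
        _ = 0 := hX3
    rw [hX] at this
    linear_combination this
  obtain ⟨m, hm⟩ := hcong
  have hc0 : (0 : ℝ) < c := by exact_mod_cast hc
  have hreal : (ρ₁ : ℝ) * h₁ * k / c - (ρ₂ : ℝ) * h₂ * k / c =
      ((a * k * ((h₁ : ℤ) * q₂ - (h₂ : ℤ) * q₁) : ℤ) : ℝ) * (ι : ℝ) / c + ((m : ℤ) : ℝ) := by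
    have := congrArg (fun z : ℤ => (z : ℝ)) hm
    push_cast at this ⊢
    field_simp
    linear_combination this
  rw [← e_neg_eq_conj, ← Circle.coe_mul, ← AddChar.map_add_eq_mul, ← sub_eq_add_neg, hreal]
  unfold eInv
  rw [e_add_intCast]

/-! ### Expanding the square: the smoothed block sum as a sum over `T = [1,K] × pairs` -/

/-- The summand of `innerAk` with the coprimality condition as an indicator. [folklore] -/
def aterm (a : ℤ) (α : ℕ → ℕ → ℂ) (c d k : ℕ) (x : ℕ × ℕ) : ℂ :=
  if c.Coprime (d * x.2) then
    α x.1 x.2 * (𝐞 (((((a : ZMod c) * ((d * x.2 : ℕ) : ZMod c)⁻¹).val : ℕ) : ℝ) * x.1 * k / c) : ℂ)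
  else 0

/-- The inner sum of `𝒜` as a sum of `aterm` over the box `[1,H] × [1,Q]`. [folklore] -/
theorem innerAk_eq_sum_aterm (a : ℤ) (H Q : ℕ) (α : ℕ → ℕ → ℂ) (c d k : ℕ) :
    innerAk a H (Q : ℝ) α c d k = ∑ x ∈ Finset.Icc 1 H ×ˢ Finset.Icc 1 Q, aterm a α c d k x := by
  unfold innerAk aterm
  rw [Nat.floor_natCast, Finset.sum_product]
  refine Finset.sum_congr rfl fun h _ => ?_
  rw [Finset.sum_filter]

/-- The smoothed block `∑_{c ≤ cM} ∑_{d ≤ dM} g(c,d) ∑_{k ≤ K} |∑_{h ≤ H} ∑_{q ≤ Q,(c,dq)=1} α(h,q) e(ahk (dq)‾/c)|²`.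
[cite: BombieriFriedlanderIwaniecActa1986, §8 p. 227] -/
def blockA (a : ℤ) (g : ℕ → ℕ → ℝ) (cM dM K H Q : ℕ) (α : ℕ → ℕ → ℂ) : ℝ :=
  ∑ c ∈ Finset.Icc 1 cM, ∑ d ∈ Finset.Icc 1 dM, g c d *
    ∑ k ∈ Finset.Icc 1 K, ‖innerAk a H (Q : ℝ) α c d k‖ ^ 2

/-- `blockA ≥ 0` for `g ≥ 0`. [folklore] -/
theorem blockA_nonneg (a : ℤ) {g : ℕ → ℕ → ℝ} (hg : ∀ c d, 0 ≤ g c d) (cM dM K H Q : ℕ)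
    (α : ℕ → ℕ → ℂ) : 0 ≤ blockA a g cM dM K H Q α :=
  Finset.sum_nonneg fun c _ => Finset.sum_nonneg fun d _ =>
    mul_nonneg (hg c d) (Finset.sum_nonneg fun _ _ => by positivity)

/-- The index set `T = [1, K] × pairs`. [folklore] -/
def tset (K H Q : ℕ) : Finset (ℕ × ((ℕ × ℕ) × (ℕ × ℕ))) := Finset.Icc 1 K ×ˢ pairs H Q

/-- `Z = ∑_{t ∈ T} w_t · Inner(a k m_t, r_t)`. [folklore] -/
def Zsum (a : ℤ) (g : ℕ → ℕ → ℝ) (cM dM K H Q : ℕ) (α : ℕ → ℕ → ℂ) : ℂ :=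
  ∑ t ∈ tset K H Q, wt α t.2 * inner g cM dM (a * t.1 * mval t.2) (rval t.2)

/-- `|z|² = z · conj z` (as complex numbers). [folklore] -/
theorem ofReal_norm_sq_eq_mul_conj (z : ℂ) : ((‖z‖ ^ 2 : ℝ) : ℂ) = z * conj z := by
  rw [Complex.mul_conj, Complex.normSq_eq_norm_sq]

/-- `(q₁q₂d, c) = 1 ↔ (c, dq₁) = (c, dq₂) = 1`. [folklore] -/
theorem coprime_prod_iff (c d q₁ q₂ : ℕ) :
    (q₁ * q₂ * d).Coprime c ↔ c.Coprime (d * q₁) ∧ c.Coprime (d * q₂) := by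
  rw [Nat.coprime_mul_iff_left, Nat.coprime_mul_iff_left, Nat.coprime_mul_iff_right,
    Nat.coprime_mul_iff_right, Nat.coprime_comm (n := q₁), Nat.coprime_comm (n := q₂),
    Nat.coprime_comm (n := d)]
  tauto

/-- `aterm` under the coprimality condition. [folklore] -/
theorem aterm_of_coprime (a : ℤ) (α : ℕ → ℕ → ℂ) {c d : ℕ} (k : ℕ) {x : ℕ × ℕ}
    (h : c.Coprime (d * x.2)) :
    aterm a α c d k x =
      α x.1 x.2 * (𝐞 (((((a : ZMod c) * ((d * x.2 : ℕ) : ZMod c)⁻¹).val : ℕ) : ℝ) * x.1 * k / c) : ℂ) :=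
  if_pos h

/-- `aterm = 0` off the coprimality condition. [folklore] -/
theorem aterm_of_not_coprime (a : ℤ) (α : ℕ → ℕ → ℂ) {c d : ℕ} (k : ℕ) {x : ℕ × ℕ}
    (h : ¬ c.Coprime (d * x.2)) : aterm a α c d k x = 0 :=
  if_neg h

/-- The `(c, d)`-term of the expanded square for a fixed index `t = (k, p)`. [folklore] -/
theorem g_mul_aterm_mul_conj (a : ℤ) (α : ℕ → ℕ → ℂ) (g : ℕ → ℕ → ℝ) {c : ℕ} (hc : 0 < c)
    (d k : ℕ) (p : (ℕ × ℕ) × (ℕ × ℕ)) :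
    ((g c d : ℝ) : ℂ) * (aterm a α c d k p.1 * conj (aterm a α c d k p.2)) =
      wt α p * (if (rval p * d).Coprime c then ((g c d : ℝ) : ℂ) * eInv c (rval p * d) (a * k * mval p)
        else 0) := by
  by_cases h1 : c.Coprime (d * p.1.2)
  · by_cases h2 : c.Coprime (d * p.2.2)
    · have h3 : (rval p * d).Coprime c := (coprime_prod_iff c d p.1.2 p.2.2).2 ⟨h1, h2⟩
      rw [aterm_of_coprime a α k h1, aterm_of_coprime a α k h2, if_pos h3, map_mul]
      have key : eInv c (rval p * d) (a * k * mval p) = _ := (phase_mul_conj hc a h1 h2 p.1.1 p.2.1 k).symm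
      rw [key]
      unfold wt
      ring
    · have h3 : ¬ (rval p * d).Coprime c := fun h => h2 ((coprime_prod_iff c d p.1.2 p.2.2).1 h).2
      rw [aterm_of_not_coprime a α k h2, if_neg h3]
      simp
  · have h3 : ¬ (rval p * d).Coprime c := fun h => h1 ((coprime_prod_iff c d p.1.2 p.2.2).1 h).1
    rw [aterm_of_not_coprime a α k h1, if_neg h3]
    simp

/-- Summing the `(c, d)`-terms: `∑_c ∑_d g (aterm·conj aterm) = w_t · Inner(a k m_t, r_t)`. [folklore] -/
theorem sum_g_mul_aterm_mul_conj (a : ℤ) (α : ℕ → ℕ → ℂ) (g : ℕ → ℕ → ℝ) (cM dM k : ℕ)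
    (p : (ℕ × ℕ) × (ℕ × ℕ)) :
    ∑ c ∈ Finset.Icc 1 cM, ∑ d ∈ Finset.Icc 1 dM,
        ((g c d : ℝ) : ℂ) * (aterm a α c d k p.1 * conj (aterm a α c d k p.2)) =
      wt α p * inner g cM dM (a * k * mval p) (rval p) := by
  unfold inner
  rw [Finset.mul_sum]
  refine Finset.sum_congr rfl fun c hc => ?_
  have hc0 : 0 < c := (Finset.mem_Icc.1 hc).1
  rw [Finset.sum_filter, Finset.mul_sum]
  refine Finset.sum_congr rfl fun d _ => ?_
  rw [g_mul_aterm_mul_conj a α g hc0 d k p]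

/-- **The expanded square**: `blockA = Z` (as complex numbers).
[cite: BombieriFriedlanderIwaniecActa1986, §8 p. 227 ("Squaring and changing the order of summation")] -/
theorem blockA_eq_Zsum (a : ℤ) (g : ℕ → ℕ → ℝ) (cM dM K H Q : ℕ) (α : ℕ → ℕ → ℂ) :
    ((blockA a g cM dM K H Q α : ℝ) : ℂ) = Zsum a g cM dM K H Q α := by
  unfold blockA Zsum tset
  push_cast
  -- `|S|² = ∑_{p ∈ pairs} aterm(p.1) conj aterm(p.2)`
  have hsq : ∀ c d k : ℕ, (((‖innerAk a H (Q : ℝ) α c d k‖ : ℝ) : ℂ)) ^ 2 =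
      ∑ p ∈ pairs H Q, aterm a α c d k p.1 * conj (aterm a α c d k p.2) := by
    intro c d k
    rw [← Complex.ofReal_pow, ofReal_norm_sq_eq_mul_conj, innerAk_eq_sum_aterm, map_sum,
      Finset.sum_mul_sum, ← Finset.sum_product']
    rfl
  simp_rw [hsq, Finset.mul_sum]
  -- reorder: `∑_c ∑_d ∑_k ∑_p = ∑_k ∑_p ∑_c ∑_d`
  rw [Finset.sum_product]
  simp_rw [← sum_g_mul_aterm_mul_conj a α g cM dM]
  simp_rw [Finset.sum_comm (s := Finset.Icc 1 dM) (t := Finset.Icc 1 K)]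
  rw [Finset.sum_comm (s := Finset.Icc 1 cM) (t := Finset.Icc 1 K)]
  simp_rw [Finset.sum_comm (s := Finset.Icc 1 dM) (t := pairs H Q)]
  simp_rw [Finset.sum_comm (s := Finset.Icc 1 cM) (t := pairs H Q)]

/-! ### Splitting `Z` according to the sign of `m = h₁q₂ − h₂q₁` -/

/-- A partial sum of `Z` over a subset `S ⊆ T`. [folklore] -/
def Zpart (S : Finset (ℕ × ((ℕ × ℕ) × (ℕ × ℕ)))) (a : ℤ) (g : ℕ → ℕ → ℝ) (cM dM : ℕ)
    (α : ℕ → ℕ → ℂ) : ℂ :=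
  ∑ t ∈ S, wt α t.2 * inner g cM dM (a * t.1 * mval t.2) (rval t.2)

/-- `T₀ = {m = 0}`, `T₊ = {m > 0}`, `T₋ = {m < 0}`. [folklore] -/
def tsetZero (K H Q : ℕ) : Finset (ℕ × ((ℕ × ℕ) × (ℕ × ℕ))) :=
  (tset K H Q).filter (fun t => mval t.2 = 0)

/-- `T₊ = {t ∈ T : m_t > 0}`. [folklore] -/
def tsetPos (K H Q : ℕ) : Finset (ℕ × ((ℕ × ℕ) × (ℕ × ℕ))) :=
  (tset K H Q).filter (fun t => 0 < mval t.2)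

/-- `T₋ = {t ∈ T : m_t < 0}`. [folklore] -/
def tsetNeg (K H Q : ℕ) : Finset (ℕ × ((ℕ × ℕ) × (ℕ × ℕ))) :=
  (tset K H Q).filter (fun t => mval t.2 < 0)

/-- `Z = Z₀ + Z₊ + Z₋`. [folklore] -/
theorem Zsum_eq_three_parts (a : ℤ) (g : ℕ → ℕ → ℝ) (cM dM K H Q : ℕ) (α : ℕ → ℕ → ℂ) :
    Zsum a g cM dM K H Q α =
      Zpart (tsetZero K H Q) a g cM dM α + Zpart (tsetPos K H Q) a g cM dM α +
        Zpart (tsetNeg K H Q) a g cM dM α := by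
  unfold Zsum Zpart tsetZero tsetPos tsetNeg
  rw [← Finset.sum_filter_add_sum_filter_not (tset K H Q) (fun t => mval t.2 = 0), add_assoc]
  congr 1
  rw [← Finset.sum_filter_add_sum_filter_not ((tset K H Q).filter (fun t => ¬ mval t.2 = 0))
    (fun t => 0 < mval t.2), Finset.filter_filter, Finset.filter_filter]
  congr 1
  · refine Finset.sum_congr (Finset.filter_congr fun t _ => ?_) fun _ _ => rfl
    constructor
    · exact fun h => h.2
    · exact fun h => ⟨h.ne', h⟩
  · refine Finset.sum_congr (Finset.filter_congr fun t _ => ?_) fun _ _ => rfl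
    constructor
    · intro h; omega
    · intro h; omega

/-- **`Z₋ = conj Z₊`** (swap `(h₁,q₁) ↔ (h₂,q₂)`: `m ↦ −m`, `r ↦ r`, `w ↦ conj w`, and
`Inner(−n, r) = conj Inner(n, r)` as `g` is real). [folklore] -/
theorem Zpart_neg_eq_conj (a : ℤ) (g : ℕ → ℕ → ℝ) (cM dM K H Q : ℕ) (α : ℕ → ℕ → ℂ) :
    Zpart (tsetNeg K H Q) a g cM dM α = conj (Zpart (tsetPos K H Q) a g cM dM α) := by
  unfold Zpart
  rw [map_sum]
  refine Finset.sum_nbij' (fun t => (t.1, t.2.swap)) (fun t => (t.1, t.2.swap)) ?_ ?_ ?_ ?_ ?_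
  · intro t ht
    simp only [tsetNeg, tsetPos, tset, Finset.mem_filter, Finset.mem_product] at ht ⊢
    exact ⟨⟨ht.1.1, swap_mem_pairs ht.1.2⟩, by rw [mval_swap]; linarith⟩
  · intro t ht
    simp only [tsetNeg, tsetPos, tset, Finset.mem_filter, Finset.mem_product] at ht ⊢
    exact ⟨⟨ht.1.1, swap_mem_pairs ht.1.2⟩, by rw [mval_swap]; linarith⟩
  · intro t _; simp
  · intro t _; simp
  · intro t _
    simp only
    rw [map_mul, wt_swap, Complex.conj_conj, mval_swap, rval_swap, ← inner_neg]
    congr 2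
    ring

/-- **`blockA ≤ |Z₀| + 2|Z₊|`.** [folklore] -/
theorem blockA_le_parts (a : ℤ) (g : ℕ → ℕ → ℝ) (cM dM K H Q : ℕ) (α : ℕ → ℕ → ℂ) :
    blockA a g cM dM K H Q α ≤
      ‖Zpart (tsetZero K H Q) a g cM dM α‖ + 2 * ‖Zpart (tsetPos K H Q) a g cM dM α‖ := by
  have h := blockA_eq_Zsum a g cM dM K H Q α
  rw [Zsum_eq_three_parts, Zpart_neg_eq_conj] at h
  have hre := congrArg Complex.re h
  rw [Complex.ofReal_re, Complex.add_re, Complex.add_re, Complex.conj_re] at hre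
  rw [hre]
  have h1 := Complex.re_le_norm (Zpart (tsetZero K H Q) a g cM dM α)
  have h2 := Complex.re_le_norm (Zpart (tsetPos K H Q) a g cM dM α)
  linarith

/-! ### The diagonal part `Z₀` -/

/-- `|Z₀| ≤ ♯T₀ · ∑_{c,d} g(c,d)` (trivially, for `g ≥ 0`, `|α| ≤ 1`). [folklore] -/
theorem norm_Zpart_zero_le (a : ℤ) {g : ℕ → ℕ → ℝ} (hg : ∀ c d, 0 ≤ g c d) (cM dM K H Q : ℕ)
    {α : ℕ → ℕ → ℂ} (hα : ∀ h q, ‖α h q‖ ≤ 1) :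
    ‖Zpart (tsetZero K H Q) a g cM dM α‖ ≤
      #(tsetZero K H Q) * ∑ c ∈ Finset.Icc 1 cM, ∑ d ∈ Finset.Icc 1 dM, g c d := by
  unfold Zpart
  refine (norm_sum_le _ _).trans ?_
  calc ∑ t ∈ tsetZero K H Q, ‖wt α t.2 * inner g cM dM (a * t.1 * mval t.2) (rval t.2)‖
      ≤ ∑ t ∈ tsetZero K H Q, ∑ c ∈ Finset.Icc 1 cM, ∑ d ∈ Finset.Icc 1 dM, g c d := by
        refine Finset.sum_le_sum fun t _ => ?_
        rw [norm_mul]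
        calc ‖wt α t.2‖ * ‖inner g cM dM (a * t.1 * mval t.2) (rval t.2)‖
            ≤ 1 * ∑ c ∈ Finset.Icc 1 cM, ∑ d ∈ Finset.Icc 1 dM, g c d :=
              mul_le_mul (norm_wt_le hα _) (norm_inner_le hg _ _ _ _) (norm_nonneg _) zero_le_one
          _ = _ := one_mul _
    _ = #(tsetZero K H Q) * ∑ c ∈ Finset.Icc 1 cM, ∑ d ∈ Finset.Icc 1 dM, g c d := by
        rw [Finset.sum_const, nsmul_eq_mul]

/-- `♯T₀ = K · ∑_{q₁,q₂ ≤ Q} ♯{h₁,h₂ ≤ H : h₁q₂ = h₂q₁}`. [folklore] -/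
theorem card_tsetZero (K H Q : ℕ) :
    (#(tsetZero K H Q) : ℝ) = K * ∑ q₁ ∈ Finset.Icc 1 Q, ∑ q₂ ∈ Finset.Icc 1 Q, (#(diagPairs q₁ q₂ H) : ℝ) := by
  have h1 : tsetZero K H Q = Finset.Icc 1 K ×ˢ (pairs H Q).filter (fun p => mval p = 0) := by
    unfold tsetZero tset
    exact Finset.filter_product_right (q := fun p => mval p = 0)
  rw [h1, Finset.card_product, Nat.card_Icc, add_tsub_cancel_right, Nat.cast_mul]
  congr 1
  -- the count over `pairs`
  have h2 : ∀ q₁ q₂ : ℕ, (#(diagPairs q₁ q₂ H) : ℝ) =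
      ∑ h₁ ∈ Finset.Icc 1 H, ∑ h₂ ∈ Finset.Icc 1 H, if h₁ * q₂ = h₂ * q₁ then (1 : ℝ) else 0 := by
    intro q₁ q₂
    unfold diagPairs
    rw [Finset.card_filter, Nat.cast_sum, Finset.sum_product]
    refine Finset.sum_congr rfl fun h₁ _ => Finset.sum_congr rfl fun h₂ _ => ?_
    split_ifs <;> simp
  simp_rw [h2]
  rw [Finset.card_filter, Nat.cast_sum, pairs, Finset.sum_product, Finset.sum_product]
  simp_rw [Finset.sum_product]
  -- match the indicators
  have h3 : ∀ h₁ q₁ h₂ q₂ : ℕ, ((if mval ((h₁, q₁), (h₂, q₂)) = 0 then 1 else 0 : ℕ) : ℝ) =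
      if h₁ * q₂ = h₂ * q₁ then (1 : ℝ) else 0 := by
    intro h₁ q₁ h₂ q₂
    unfold mval
    simp only [sub_eq_zero]
    by_cases h : h₁ * q₂ = h₂ * q₁
    · rw [if_pos h, if_pos (by exact_mod_cast h)]; simp
    · rw [if_neg h, if_neg (fun h' => h (by exact_mod_cast h'))]; simp
  simp_rw [h3]
  -- reorder `∑_{h₁} ∑_{q₁} ∑_{h₂} ∑_{q₂} = ∑_{q₁} ∑_{q₂} ∑_{h₁} ∑_{h₂}`
  simp_rw [Finset.sum_comm (s := Finset.Icc 1 H) (t := Finset.Icc 1 Q)]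

/-! ### The positive part `Z₊`: the coefficients `B(n, r)` -/

/-- `n_t = a k (h₁q₂ − h₂q₁)` as a natural number (for `t ∈ T₊`, `a = A ≥ 1`). [folklore] -/
def nNat (A : ℕ) (t : ℕ × ((ℕ × ℕ) × (ℕ × ℕ))) : ℕ :=
  A * t.1 * (t.2.1.1 * t.2.2.2 - t.2.2.1 * t.2.1.2)

/-- On `T₊`, the natural number `nNat` is the integer `a k m_t`. [folklore] -/
theorem natCast_nNat (A : ℕ) {t : ℕ × ((ℕ × ℕ) × (ℕ × ℕ))} (ht : 0 < mval t.2) :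
    ((nNat A t : ℕ) : ℤ) = (A : ℤ) * t.1 * mval t.2 := by
  unfold mval at *
  unfold nNat
  have hle : t.2.2.1 * t.2.1.2 ≤ t.2.1.1 * t.2.2.2 := by
    have : (t.2.2.1 : ℤ) * t.2.1.2 ≤ t.2.1.1 * t.2.2.2 := by linarith
    exact_mod_cast this
  push_cast [Nat.cast_sub hle]
  ring

/-- **The coefficients `B(n, r)`** (BFI p. 227: `B_{nr} = ∑_{q₁q₂=r} ∑_{ak(h₁q₂−h₂q₁)=n} ∑_k α(h₁,q₁) ᾱ(h₂,q₂)`):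
the sum of the weights `w_t` over the fibre of `t ↦ (n_t, r_t)` in `T₊`.
[cite: BombieriFriedlanderIwaniecActa1986, §8 p. 227] -/
def Bcoef (A : ℕ) (α : ℕ → ℕ → ℂ) (K H Q : ℕ) (y : ℕ × ℕ) : ℂ :=
  ∑ t ∈ (tsetPos K H Q).filter (fun t => (nNat A t, rval t.2) = y), wt α t.2

/-- Membership in `T₊`, unfolded. [folklore] -/
theorem mem_tsetPos {K H Q : ℕ} {t : ℕ × ((ℕ × ℕ) × (ℕ × ℕ))} :
    t ∈ tsetPos K H Q ↔
      (1 ≤ t.1 ∧ t.1 ≤ K) ∧ (((1 ≤ t.2.1.1 ∧ t.2.1.1 ≤ H) ∧ (1 ≤ t.2.1.2 ∧ t.2.1.2 ≤ Q)) ∧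
        ((1 ≤ t.2.2.1 ∧ t.2.2.1 ≤ H) ∧ (1 ≤ t.2.2.2 ∧ t.2.2.2 ≤ Q))) ∧ 0 < mval t.2 := by
  simp only [tsetPos, tset, pairs, Finset.mem_filter, Finset.mem_product, Finset.mem_Icc, and_assoc]

/-- The key `(n_t, r_t)` of `t ∈ T₊` lies in `[1, AKHQ] × [1, R♭]` for `R♭ ≥ Q²`. [folklore] -/
theorem key_mem {A K H Q : ℕ} (hA : 1 ≤ A) {t : ℕ × ((ℕ × ℕ) × (ℕ × ℕ))} (ht : t ∈ tsetPos K H Q)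
    {Rb : ℕ} (hRb : Q * Q ≤ Rb) :
    (nNat A t, rval t.2) ∈ Finset.Icc 1 (A * K * (H * Q)) ×ˢ Finset.Icc 1 Rb := by
  rw [mem_tsetPos] at ht
  obtain ⟨⟨hk1, hk2⟩, ⟨⟨⟨hh1, hh1'⟩, ⟨hq1, hq1'⟩⟩, ⟨⟨hh2, hh2'⟩, ⟨hq2, hq2'⟩⟩⟩, hm⟩ := ht
  unfold mval at hm
  have hlt : t.2.2.1 * t.2.1.2 < t.2.1.1 * t.2.2.2 := by
    have : (t.2.2.1 : ℤ) * t.2.1.2 < t.2.1.1 * t.2.2.2 := by linarith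
    exact_mod_cast this
  rw [Finset.mem_product, Finset.mem_Icc, Finset.mem_Icc]
  unfold nNat rval
  refine ⟨⟨?_, ?_⟩, ?_, ?_⟩
  · have h1 : 1 ≤ t.2.1.1 * t.2.2.2 - t.2.2.1 * t.2.1.2 := by omega
    calc 1 = 1 * 1 * 1 := by ring
      _ ≤ A * t.1 * (t.2.1.1 * t.2.2.2 - t.2.2.1 * t.2.1.2) :=
        Nat.mul_le_mul (Nat.mul_le_mul hA hk1) h1
  · have h1 : t.2.1.1 * t.2.2.2 - t.2.2.1 * t.2.1.2 ≤ H * Q :=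
      (Nat.sub_le _ _).trans (Nat.mul_le_mul hh1' hq2')
    exact Nat.mul_le_mul (Nat.mul_le_mul le_rfl hk2) h1
  · have : 1 * 1 ≤ t.2.1.2 * t.2.2.2 := Nat.mul_le_mul hq1 hq2
    simpa using this
  · exact (Nat.mul_le_mul hq1' hq2').trans hRb

/-- **`Z₊ = ∑_{(n,r)} B(n,r) · Inner(n, r)`** (regrouping by the fibres of `t ↦ (n_t, r_t)`).
[cite: BombieriFriedlanderIwaniecActa1986, §8 p. 227] -/
theorem Zpart_pos_eq_sum_Bcoef {A : ℕ} (hA : 1 ≤ A) (g : ℕ → ℕ → ℝ) (cM dM K H Q : ℕ)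
    (α : ℕ → ℕ → ℂ) {Rb : ℕ} (hRb : Q * Q ≤ Rb) :
    Zpart (tsetPos K H Q) (A : ℤ) g cM dM α =
      ∑ y ∈ Finset.Icc 1 (A * K * (H * Q)) ×ˢ Finset.Icc 1 Rb,
        Bcoef A α K H Q y * inner g cM dM (y.1 : ℤ) y.2 := by
  unfold Zpart Bcoef
  rw [← Finset.sum_fiberwise_of_maps_to (g := fun t => (nNat A t, rval t.2))
    (fun t ht => key_mem hA ht hRb)]
  refine Finset.sum_congr rfl fun y _ => ?_
  rw [Finset.sum_mul]
  refine Finset.sum_congr rfl fun t ht => ?_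
  rw [Finset.mem_filter] at ht
  obtain ⟨ht, hy⟩ := ht
  have hpos : 0 < mval t.2 := (Finset.mem_filter.1 ht).2
  rw [← hy]
  simp only
  rw [natCast_nNat A hpos]

/-! ### Dyadic decomposition of the `r`-range and the identification with `𝓚` -/

/-- `m ∼ 2^i/2 ↔ 2^i < 2m ∧ m ≤ 2^i`. [folklore] -/
theorem mem_dyadic_pow_half {i m : ℕ} : m ∈ dyadic ((2 : ℝ) ^ i / 2) ↔ 2 ^ i < 2 * m ∧ m ≤ 2 ^ i := by
  rw [mem_dyadic (by positivity)]
  constructor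
  · rintro ⟨h1, h2⟩
    constructor
    · have : ((2 ^ i : ℕ) : ℝ) < ((2 * m : ℕ) : ℝ) := by push_cast; linarith
      exact_mod_cast this
    · have : (m : ℝ) ≤ ((2 ^ i : ℕ) : ℝ) := by push_cast; linarith
      exact_mod_cast this
  · rintro ⟨h1, h2⟩
    constructor
    · have : ((2 ^ i : ℕ) : ℝ) < ((2 * m : ℕ) : ℝ) := by exact_mod_cast h1
      push_cast at this; linarith
    · have : (m : ℝ) ≤ ((2 ^ i : ℕ) : ℝ) := by exact_mod_cast h2
      push_cast at this; linarith

/-- `[1, 2^L] = ⨆_{i ≤ L} (2^i/2, 2^i]` for sums. [folklore] -/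
theorem sum_Icc_pow_eq_sum_dyadic {M : Type*} [AddCommMonoid M] (F : ℕ → M) (L : ℕ) :
    ∑ r ∈ Finset.Icc 1 (2 ^ L), F r =
      ∑ i ∈ Finset.range (L + 1), ∑ r ∈ dyadic ((2 : ℝ) ^ i / 2), F r := by
  induction L with
  | zero =>
    rw [Finset.sum_range_one, pow_zero]
    have : dyadic ((2 : ℝ) ^ 0 / 2) = Finset.Icc 1 1 := by
      ext m; rw [mem_dyadic_pow_half, Finset.mem_Icc]; omega
    rw [this]
  | succ L ih =>
    rw [Finset.sum_range_succ, ← ih]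
    have hsplit : Finset.Icc 1 (2 ^ (L + 1)) = Finset.Icc 1 (2 ^ L) ∪ dyadic ((2 : ℝ) ^ (L + 1) / 2) := by
      ext m
      rw [Finset.mem_union, Finset.mem_Icc, Finset.mem_Icc, mem_dyadic_pow_half, pow_succ]
      omega
    have hdisj : Disjoint (Finset.Icc 1 (2 ^ L)) (dyadic ((2 : ℝ) ^ (L + 1) / 2)) := by
      rw [Finset.disjoint_left]
      intro m hm hm'
      rw [Finset.mem_Icc] at hm
      rw [mem_dyadic_pow_half, pow_succ] at hm'
      omega
    rw [hsplit, Finset.sum_union hdisj]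

/-- The dyadic blocks `(2^i/2, 2^i]`, `i ≤ L`, lie in `[1, 2^L]`. [folklore] -/
theorem dyadic_pow_half_subset {i L : ℕ} (hi : i ≤ L) :
    dyadic ((2 : ℝ) ^ i / 2) ⊆ Finset.Icc 1 (2 ^ L) := by
  intro m hm
  rw [mem_dyadic_pow_half] at hm
  rw [Finset.mem_Icc]
  have : 2 ^ i ≤ 2 ^ L := Nat.pow_le_pow_right (by norm_num) hi
  have : 1 ≤ 2 ^ i := Nat.one_le_two_pow
  omega

/-- `s ∼ 1/2` means `s = 1`. [folklore] -/
theorem dyadic_half : dyadic (1 / 2 : ℝ) = {1} := by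
  ext m
  rw [Finset.mem_singleton]
  have h := @mem_dyadic_pow_half 0 m
  rw [pow_zero] at h
  rw [h]
  omega

/-- The Kloosterman phase only depends on the modulus up to (propositional) equality. [folklore] -/
theorem kphase_congr {m m' : ℕ} (h : m = m') (x : ℕ) (u : ℝ) :
    (𝐞 (u * ((((x : ℕ) : ZMod m))⁻¹.val : ℝ) / (m : ℝ)) : ℂ) =
      (𝐞 (u * ((((x : ℕ) : ZMod m'))⁻¹.val : ℝ) / (m' : ℝ)) : ℂ) := by
  subst h; rfl

/-- **`𝓚` at `S = 1/2`** (`s ∼ 1/2` means `s = 1`): `𝓚(g; cM, dM, N, R, 1/2; B) = ∑_{r∼R} ∑_{n≤N} B(n,r,1) Inner(n, r)`.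
[folklore] -/
theorem dispK_half_eq (g : ℕ → ℕ → ℝ) (cM dM N : ℕ) (R : ℝ) (B : ℕ → ℕ → ℕ → ℂ) :
    dispK g cM dM N R (1 / 2) B =
      ∑ r ∈ dyadic R, ∑ n ∈ Finset.Icc 1 N, B n r 1 * inner g cM dM (n : ℤ) r := by
  unfold dispK inner eInv
  refine Finset.sum_congr rfl fun r _ => ?_
  rw [dyadic_half, Finset.sum_singleton]
  refine Finset.sum_congr rfl fun n _ => ?_
  congr 1
  refine Finset.sum_congr rfl fun c _ => ?_
  have hc : 1 * c = c := one_mul c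
  have hfilt : (Finset.Icc 1 dM).filter (fun d => (r * d).Coprime (1 * c)) =
      (Finset.Icc 1 dM).filter (fun d => (r * d).Coprime c) :=
    Finset.filter_congr (fun d _ => by rw [hc])
  rw [hfilt]
  refine Finset.sum_congr rfl fun d _ => ?_
  congr 1
  rw [kphase_congr hc (r * d) (n : ℝ), Int.cast_natCast]

/-- **`Z₊` as a sum of `L + 1` sums `𝓚`** over the dyadic blocks `r ∼ 2^i/2`, `0 ≤ i ≤ L`, with
`2^L ≥ Q²`, each at `S = 1/2`, `N = AKHQ`, with the coefficients `B(n, r)`. [folklore] -/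
theorem Zpart_pos_eq_sum_dispK {A : ℕ} (hA : 1 ≤ A) (g : ℕ → ℕ → ℝ) (cM dM K H Q : ℕ)
    (α : ℕ → ℕ → ℂ) {L : ℕ} (hL : Q * Q ≤ 2 ^ L) :
    Zpart (tsetPos K H Q) (A : ℤ) g cM dM α =
      ∑ i ∈ Finset.range (L + 1),
        dispK g cM dM (A * K * (H * Q)) ((2 : ℝ) ^ i / 2) (1 / 2) (fun n r _ => Bcoef A α K H Q (n, r)) := by
  rw [Zpart_pos_eq_sum_Bcoef hA g cM dM K H Q α hL, Finset.sum_product, Finset.sum_comm,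
    sum_Icc_pow_eq_sum_dyadic]
  refine Finset.sum_congr rfl fun i _ => ?_
  rw [dispK_half_eq]

/-! ### The bound for `‖B‖²` -/

/-- The fibre of `t ↦ (n_t, r_t)` over `y = (n, r)` in `T₊`. [folklore] -/
def fiber (A K H Q : ℕ) (y : ℕ × ℕ) : Finset (ℕ × ((ℕ × ℕ) × (ℕ × ℕ))) :=
  (tsetPos K H Q).filter (fun t => (nNat A t, rval t.2) = y)

/-- `B(y)` as the sum of the weights over the fibre of `y`. [folklore] -/
theorem Bcoef_eq (A : ℕ) (α : ℕ → ℕ → ℂ) (K H Q : ℕ) (y : ℕ × ℕ) :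
    Bcoef A α K H Q y = ∑ t ∈ fiber A K H Q y, wt α t.2 := rfl

/-- `|B(n,r)| ≤ ♯ fibre`. [folklore] -/
theorem norm_Bcoef_le (A : ℕ) {α : ℕ → ℕ → ℂ} (hα : ∀ h q, ‖α h q‖ ≤ 1) (K H Q : ℕ) (y : ℕ × ℕ) :
    ‖Bcoef A α K H Q y‖ ≤ #(fiber A K H Q y) := by
  rw [Bcoef_eq]
  refine (norm_sum_le _ _).trans ?_
  calc ∑ t ∈ fiber A K H Q y, ‖wt α t.2‖ ≤ ∑ t ∈ fiber A K H Q y, (1 : ℝ) :=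
        Finset.sum_le_sum fun t _ => norm_wt_le hα _
    _ = #(fiber A K H Q y) := by rw [Finset.sum_const, nsmul_eq_mul, mul_one]

/-- The projection `t ↦ (k, q₁, q₂)`. [folklore] -/
def proj (t : ℕ × ((ℕ × ℕ) × (ℕ × ℕ))) : ℕ × (ℕ × ℕ) := (t.1, (t.2.1.2, t.2.2.2))

/-- The range of `proj`: `[1,K] × [1,Q]²`. [folklore] -/
def Zset (K Q : ℕ) : Finset (ℕ × (ℕ × ℕ)) := Finset.Icc 1 K ×ˢ (Finset.Icc 1 Q ×ˢ Finset.Icc 1 Q)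

/-- `μ_z(y) = ♯{t ∈ fibre(y) : proj t = z}`. [folklore] -/
def mu (A K H Q : ℕ) (z : ℕ × (ℕ × ℕ)) (y : ℕ × ℕ) : ℕ :=
  #((fiber A K H Q y).filter (fun t => proj t = z))

/-- `proj` maps `T₊` into `[1,K] × [1,Q]²`. [folklore] -/
theorem proj_mem_Zset {K H Q : ℕ} {t : ℕ × ((ℕ × ℕ) × (ℕ × ℕ))} (ht : t ∈ tsetPos K H Q) :
    proj t ∈ Zset K Q := by
  rw [mem_tsetPos] at ht
  simp only [Zset, proj, Finset.mem_product, Finset.mem_Icc]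
  exact ⟨ht.1, ht.2.1.1.2, ht.2.1.2.2⟩

/-- `♯ fibre(y) = ∑_z μ_z(y)`. [folklore] -/
theorem card_fiber_eq_sum_mu (A K H Q : ℕ) (y : ℕ × ℕ) :
    #(fiber A K H Q y) = ∑ z ∈ Zset K Q, mu A K H Q z y := by
  unfold mu
  refine Finset.card_eq_sum_card_fiberwise fun t ht => ?_
  exact proj_mem_Zset (Finset.mem_filter.1 ht).1

/-- Facts about an element of `fibre(y) ∩ proj⁻¹(z)`. [folklore] -/
theorem of_mem_fiber_filter {A K H Q : ℕ} {z : ℕ × (ℕ × ℕ)} {y : ℕ × ℕ}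
    {t : ℕ × ((ℕ × ℕ) × (ℕ × ℕ))} (ht : t ∈ (fiber A K H Q y).filter (fun t => proj t = z)) :
    t ∈ tsetPos K H Q ∧ nNat A t = y.1 ∧ rval t.2 = y.2 ∧ t.1 = z.1 ∧ t.2.1.2 = z.2.1 ∧ t.2.2.2 = z.2.2 := by
  simp only [fiber, Finset.mem_filter, proj, Prod.ext_iff] at ht
  exact ⟨ht.1.1, ht.1.2.1, ht.1.2.2, ht.2.1, ht.2.2.1, ht.2.2.2⟩

/-- **The support of `z ↦ μ_z(y)` has at most `τ(n)τ(r)` elements** (`k ∣ n`, `q₁ ∣ r`, and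
`q₂ = r/q₁`). [folklore] -/
theorem card_support_mu_le {A K H Q : ℕ} {y : ℕ × ℕ} (hy1 : y.1 ≠ 0) (hy2 : y.2 ≠ 0) :
    #((Zset K Q).filter (fun z => mu A K H Q z y ≠ 0)) ≤ #y.1.divisors * #y.2.divisors := by
  rw [← Finset.card_product]
  refine Finset.card_le_card_of_injOn (fun z => (z.1, z.2.1)) ?_ ?_
  · intro z hz
    rw [Finset.mem_coe, Finset.mem_filter] at hz
    obtain ⟨t, ht⟩ := Finset.card_ne_zero.1 hz.2
    obtain ⟨htP, hn, hr, hk, hq1, hq2⟩ := of_mem_fiber_filter ht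
    simp only [Finset.mem_coe, Finset.mem_product, Nat.mem_divisors]
    refine ⟨⟨?_, hy1⟩, ⟨?_, hy2⟩⟩
    · rw [← hn, ← hk]; exact ⟨A * (t.2.1.1 * t.2.2.2 - t.2.2.1 * t.2.1.2), by unfold nNat; ring⟩
    · rw [← hr, ← hq1]; exact ⟨t.2.2.2, rfl⟩
  · intro z hz z' hz' hzz
    rw [Finset.mem_coe, Finset.mem_filter] at hz hz'
    obtain ⟨t, ht⟩ := Finset.card_ne_zero.1 hz.2
    obtain ⟨htP, hn, hr, hk, hq1, hq2⟩ := of_mem_fiber_filter ht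
    obtain ⟨t', ht'⟩ := Finset.card_ne_zero.1 hz'.2
    obtain ⟨htP', hn', hr', hk', hq1', hq2'⟩ := of_mem_fiber_filter ht'
    simp only [Prod.mk.injEq] at hzz
    have hq1pos : 0 < t.2.1.2 := (mem_tsetPos.1 htP).2.1.1.2.1
    -- `q₂ = r / q₁`
    have e1 : z.2.2 = y.2 / z.2.1 := by
      rw [← hq2, ← hr, ← hq1]; unfold rval; rw [Nat.mul_div_cancel_left _ hq1pos]
    have e2 : z'.2.2 = y.2 / z'.2.1 := by
      have hq1pos' : 0 < t'.2.1.2 := (mem_tsetPos.1 htP').2.1.1.2.1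
      rw [← hq2', ← hr', ← hq1']; unfold rval; rw [Nat.mul_div_cancel_left _ hq1pos']
    have e3 : z.2.2 = z'.2.2 := by rw [e1, e2, hzz.2]
    exact Prod.ext hzz.1 (Prod.ext hzz.2 e3)

/-- `(∑_{z} f z)² ≤ ♯{f ≠ 0} · ∑_z f z²` (Cauchy–Schwarz on the support). [folklore] -/
theorem sq_sum_le_card_support_mul {ι : Type*} (s : Finset ι) (f : ι → ℕ) :
    ((∑ z ∈ s, f z : ℕ) : ℝ) ^ 2 ≤ #(s.filter (fun z => f z ≠ 0)) * ∑ z ∈ s, ((f z : ℕ) : ℝ) ^ 2 := by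
  have h1 : ∑ z ∈ s, f z = ∑ z ∈ s.filter (fun z => f z ≠ 0), f z :=
    (Finset.sum_filter_ne_zero s).symm
  have h2 : ∑ z ∈ s.filter (fun z => f z ≠ 0), ((f z : ℕ) : ℝ) ^ 2 ≤ ∑ z ∈ s, ((f z : ℕ) : ℝ) ^ 2 :=
    Finset.sum_le_sum_of_subset_of_nonneg (Finset.filter_subset _ _) fun _ _ _ => by positivity
  rw [h1, Nat.cast_sum]
  refine (sq_sum_le_card_mul_sum_sq (s := s.filter (fun z => f z ≠ 0)) (f := fun z => ((f z : ℕ) : ℝ))).trans ?_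
  exact mul_le_mul_of_nonneg_left h2 (Nat.cast_nonneg _)

/-- **`♯fibre(y)² ≤ τ(n)τ(r) ∑_z μ_z(y)²`.** [folklore] -/
theorem sq_card_fiber_le {A K H Q : ℕ} {y : ℕ × ℕ} (hy1 : y.1 ≠ 0) (hy2 : y.2 ≠ 0) :
    (#(fiber A K H Q y) : ℝ) ^ 2 ≤
      (#y.1.divisors * #y.2.divisors : ℕ) * ∑ z ∈ Zset K Q, ((mu A K H Q z y : ℕ) : ℝ) ^ 2 := by
  rw [card_fiber_eq_sum_mu]
  refine (sq_sum_le_card_support_mul _ _).trans ?_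
  refine mul_le_mul_of_nonneg_right ?_ (Finset.sum_nonneg fun _ _ => by positivity)
  exact_mod_cast card_support_mu_le hy1 hy2

/-- The `(h₁, h₂)`-projection is injective on `proj⁻¹(z)`. [folklore] -/
theorem injOn_hpair (z : ℕ × (ℕ × ℕ)) (S : Finset (ℕ × ((ℕ × ℕ) × (ℕ × ℕ))))
    (hS : ∀ t ∈ S, proj t = z) :
    Set.InjOn (fun t : ℕ × ((ℕ × ℕ) × (ℕ × ℕ)) => (t.2.1.1, t.2.2.1)) (S : Set _) := by
  intro t ht t' ht' h
  have h1 := hS t (Finset.mem_coe.1 ht)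
  have h2 := hS t' (Finset.mem_coe.1 ht')
  simp only [proj, Prod.mk.injEq] at h h1 h2
  obtain ⟨k, ⟨h₁, q₁⟩, ⟨h₂, q₂⟩⟩ := t
  obtain ⟨k', ⟨h₁', q₁'⟩, ⟨h₂', q₂'⟩⟩ := t'
  simp only at h h1 h2 ⊢
  obtain ⟨rfl, rfl, rfl⟩ := h1
  obtain ⟨rfl, rfl, rfl⟩ := h2
  obtain ⟨rfl, rfl⟩ := h
  trivial

/-- **`μ_z(y) ≤ H(q₁,q₂)/max(q₁,q₂) + 1`**: the `(h₁,h₂)` of the elements of `fibre(y) ∩ proj⁻¹(z)`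
solve `h₁q₂ − h₂q₁ = l` with `l = n/(ak)`. [cite: BombieriFriedlanderIwaniecActa1986, §8 p. 227] -/
theorem mu_le {A K H Q : ℕ} (hA : 1 ≤ A) {z : ℕ × (ℕ × ℕ)} (hz : z ∈ Zset K Q) (y : ℕ × ℕ) :
    ((mu A K H Q z y : ℕ) : ℝ) ≤
      (H : ℝ) * (Nat.gcd z.2.1 z.2.2 : ℕ) / ((max z.2.1 z.2.2 : ℕ) : ℝ) + 1 := by
  simp only [Zset, Finset.mem_product, Finset.mem_Icc] at hz
  obtain ⟨⟨hk1, _⟩, ⟨hq11, _⟩, ⟨hq21, _⟩⟩ := hz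
  have hq1 : z.2.1 ≠ 0 := by omega
  have hq2 : z.2.2 ≠ 0 := by omega
  refine le_trans ?_ (card_linePairs_le hq1 hq2 (((y.1 / (A * z.1) : ℕ) : ℤ)))
  unfold mu
  have hinj := injOn_hpair z
    ((fiber A K H Q y).filter (fun t => proj t = z)) (fun t ht => (Finset.mem_filter.1 ht).2)
  have hmaps : Set.MapsTo (fun t : ℕ × ((ℕ × ℕ) × (ℕ × ℕ)) => (t.2.1.1, t.2.2.1))
      (((fiber A K H Q y).filter (fun t => proj t = z)) : Set _)
      ((linePairs z.2.1 z.2.2 H (((y.1 / (A * z.1) : ℕ) : ℤ))) : Set _) := by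
    intro t ht
    rw [Finset.mem_coe] at ht
    obtain ⟨htP, hn, hr, hk, hq1', hq2'⟩ := of_mem_fiber_filter ht
    have hpos : 0 < mval t.2 := (mem_tsetPos.1 htP).2.2
    have hbounds := (mem_tsetPos.1 htP).2.1
    rw [Finset.mem_coe, mem_linePairs]
    refine ⟨hbounds.1.1, hbounds.2.1, ?_⟩
    -- the equation: `mval t.2 = y.1 / (A k)`
    have hAk : 0 < A * t.1 := Nat.mul_pos (by omega) (mem_tsetPos.1 htP).1.1
    have hdiff : y.1 / (A * z.1) = t.2.1.1 * t.2.2.2 - t.2.2.1 * t.2.1.2 := by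
      rw [← hn, ← hk]; unfold nNat; rw [Nat.mul_div_cancel_left _ hAk]
    have hle : t.2.2.1 * t.2.1.2 ≤ t.2.1.1 * t.2.2.2 := by
      unfold mval at hpos
      have : (t.2.2.1 : ℤ) * t.2.1.2 ≤ t.2.1.1 * t.2.2.2 := by linarith
      exact_mod_cast this
    rw [hdiff, ← hq1', ← hq2', Nat.cast_sub hle]
    push_cast
    ring
  exact_mod_cast Finset.card_le_card_of_injOn _ hmaps hinj

/-- **`∑_y μ_z(y) ≤ H²`** (the fibres over distinct `y` are disjoint subsets of `proj⁻¹(z)`, whose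
`(h₁,h₂)`-projection is injective). [folklore] -/
theorem sum_mu_le {A K H Q : ℕ} (z : ℕ × (ℕ × ℕ)) (Y : Finset (ℕ × ℕ)) :
    ((∑ y ∈ Y, mu A K H Q z y : ℕ) : ℝ) ≤ (H : ℝ) ^ 2 := by
  unfold mu fiber
  have h1 : ∀ y ∈ Y, ((tsetPos K H Q).filter (fun t => (nNat A t, rval t.2) = y)).filter (fun t => proj t = z) =
      ((tsetPos K H Q).filter (fun t => proj t = z)).filter (fun t => (nNat A t, rval t.2) = y) := by
    intro y _
    rw [Finset.filter_filter, Finset.filter_filter]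
    exact Finset.filter_congr fun t _ => and_comm
  rw [Finset.sum_congr rfl (fun y hy => congrArg Finset.card (h1 y hy)),
    Finset.sum_card_fiberwise_eq_card_filter]
  have hinj := injOn_hpair z ((tsetPos K H Q).filter (fun t => proj t = z))
    (fun t ht => (Finset.mem_filter.1 ht).2)
  have hcard : #(((tsetPos K H Q).filter (fun t => proj t = z)).filter
      (fun t => (nNat A t, rval t.2) ∈ Y)) ≤ #(Finset.Icc 1 H ×ˢ Finset.Icc 1 H) := by
    refine (Finset.card_filter_le _ _).trans ?_
    refine Finset.card_le_card_of_injOn _ (fun t ht => ?_) hinj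
    rw [Finset.mem_coe, Finset.mem_filter] at ht
    have hb := (mem_tsetPos.1 ht.1).2.1
    rw [Finset.mem_coe, Finset.mem_product, Finset.mem_Icc, Finset.mem_Icc]
    exact ⟨hb.1.1, hb.2.1⟩
  rw [Finset.card_product, Nat.card_Icc, add_tsub_cancel_right] at hcard
  calc ((#(((tsetPos K H Q).filter (fun t => proj t = z)).filter
      (fun t => (nNat A t, rval t.2) ∈ Y)) : ℕ) : ℝ) ≤ ((H * H : ℕ) : ℝ) := by exact_mod_cast hcard
    _ = (H : ℝ) ^ 2 := by push_cast; ring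

/-- **`∑_y μ_z(y)² ≤ (H(q₁,q₂)/max(q₁,q₂) + 1) H²`** (sup × sum). [folklore] -/
theorem sum_sq_mu_le {A K H Q : ℕ} (hA : 1 ≤ A) {z : ℕ × (ℕ × ℕ)} (hz : z ∈ Zset K Q)
    (Y : Finset (ℕ × ℕ)) :
    ∑ y ∈ Y, ((mu A K H Q z y : ℕ) : ℝ) ^ 2 ≤
      ((H : ℝ) * (Nat.gcd z.2.1 z.2.2 : ℕ) / ((max z.2.1 z.2.2 : ℕ) : ℝ) + 1) * (H : ℝ) ^ 2 := by
  set M : ℝ := (H : ℝ) * (Nat.gcd z.2.1 z.2.2 : ℕ) / ((max z.2.1 z.2.2 : ℕ) : ℝ) + 1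
  have hM : ∀ y, ((mu A K H Q z y : ℕ) : ℝ) ≤ M := fun y => mu_le hA hz y
  calc ∑ y ∈ Y, ((mu A K H Q z y : ℕ) : ℝ) ^ 2
      ≤ ∑ y ∈ Y, M * ((mu A K H Q z y : ℕ) : ℝ) := by
        refine Finset.sum_le_sum fun y _ => ?_
        rw [sq]
        exact mul_le_mul_of_nonneg_right (hM y) (Nat.cast_nonneg _)
    _ = M * ((∑ y ∈ Y, mu A K H Q z y : ℕ) : ℝ) := by rw [Nat.cast_sum, Finset.mul_sum]
    _ ≤ M * (H : ℝ) ^ 2 := by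
        refine mul_le_mul_of_nonneg_left (sum_mu_le z Y) ?_
        have : (0 : ℝ) ≤ (H : ℝ) * (Nat.gcd z.2.1 z.2.2 : ℕ) / ((max z.2.1 z.2.2 : ℕ) : ℝ) := by positivity
        linarith

/-- **The bound for `‖B‖²`** (BFI p. 227: `‖B‖² ≪ (HKQ)^ε K (H²Q² + H³Q)`): over any box `Y` of
keys `(n, r)` with `n, r ≥ 1` on which `τ(n) ≤ T_n`, `τ(r) ≤ T_r`,
`∑_{y ∈ Y} |B(y)|² ≤ T_n T_r · K · H² · (Q² + 2H ∑_{q ≤ Q} τ(q))`.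
[cite: BombieriFriedlanderIwaniecActa1986, §8 p. 227] -/
theorem sum_norm_sq_Bcoef_le {A K H Q : ℕ} (hA : 1 ≤ A) {α : ℕ → ℕ → ℂ} (hα : ∀ h q, ‖α h q‖ ≤ 1)
    (Y : Finset (ℕ × ℕ)) {Tn Tr : ℝ} (hTn0' : 0 ≤ Tn) (hTr0' : 0 ≤ Tr)
    (hTn : ∀ y ∈ Y, (#y.1.divisors : ℝ) ≤ Tn)
    (hTr : ∀ y ∈ Y, (#y.2.divisors : ℝ) ≤ Tr) (hY : ∀ y ∈ Y, y.1 ≠ 0 ∧ y.2 ≠ 0) :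
    ∑ y ∈ Y, ‖Bcoef A α K H Q y‖ ^ 2 ≤
      Tn * Tr * K * (H : ℝ) ^ 2 * ((Q : ℝ) ^ 2 + 2 * H * ∑ q ∈ Finset.Icc 1 Q, ((#q.divisors : ℕ) : ℝ)) := by
  -- step 1: `|B(y)|² ≤ ♯fibre² ≤ TnTr ∑_z μ_z(y)²`
  have h1 : ∀ y ∈ Y, ‖Bcoef A α K H Q y‖ ^ 2 ≤
      Tn * Tr * ∑ z ∈ Zset K Q, ((mu A K H Q z y : ℕ) : ℝ) ^ 2 := by
    intro y hy
    have hb := norm_Bcoef_le A hα K H Q y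
    calc ‖Bcoef A α K H Q y‖ ^ 2 ≤ (#(fiber A K H Q y) : ℝ) ^ 2 :=
          pow_le_pow_left₀ (norm_nonneg _) hb 2
      _ ≤ (#y.1.divisors * #y.2.divisors : ℕ) * ∑ z ∈ Zset K Q, ((mu A K H Q z y : ℕ) : ℝ) ^ 2 :=
          sq_card_fiber_le (hY y hy).1 (hY y hy).2
      _ ≤ Tn * Tr * ∑ z ∈ Zset K Q, ((mu A K H Q z y : ℕ) : ℝ) ^ 2 := by
          refine mul_le_mul_of_nonneg_right ?_ (Finset.sum_nonneg fun _ _ => by positivity)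
          push_cast
          exact mul_le_mul (hTn y hy) (hTr y hy) (Nat.cast_nonneg _) hTn0'
  -- step 2: sum over `y`, exchange, and use `sum_sq_mu_le`
  calc ∑ y ∈ Y, ‖Bcoef A α K H Q y‖ ^ 2
      ≤ ∑ y ∈ Y, Tn * Tr * ∑ z ∈ Zset K Q, ((mu A K H Q z y : ℕ) : ℝ) ^ 2 := Finset.sum_le_sum h1
    _ = Tn * Tr * ∑ z ∈ Zset K Q, ∑ y ∈ Y, ((mu A K H Q z y : ℕ) : ℝ) ^ 2 := by
        rw [← Finset.mul_sum, Finset.sum_comm]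
    _ ≤ Tn * Tr * ∑ z ∈ Zset K Q,
          ((H : ℝ) * (Nat.gcd z.2.1 z.2.2 : ℕ) / ((max z.2.1 z.2.2 : ℕ) : ℝ) + 1) * (H : ℝ) ^ 2 := by
        refine mul_le_mul_of_nonneg_left (Finset.sum_le_sum fun z hz => sum_sq_mu_le hA hz Y) ?_
        positivity
    _ = Tn * Tr * K * (H : ℝ) ^ 2 * ∑ q₁ ∈ Finset.Icc 1 Q, ∑ q₂ ∈ Finset.Icc 1 Q,
          ((H : ℝ) * (Nat.gcd q₁ q₂ : ℕ) / ((max q₁ q₂ : ℕ) : ℝ) + 1) := by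
        have hz : ∑ z ∈ Zset K Q,
            ((H : ℝ) * (Nat.gcd z.2.1 z.2.2 : ℕ) / ((max z.2.1 z.2.2 : ℕ) : ℝ) + 1) * (H : ℝ) ^ 2 =
            K * ((H : ℝ) ^ 2 * ∑ q₁ ∈ Finset.Icc 1 Q, ∑ q₂ ∈ Finset.Icc 1 Q,
              ((H : ℝ) * (Nat.gcd q₁ q₂ : ℕ) / ((max q₁ q₂ : ℕ) : ℝ) + 1)) := by
          rw [Zset, Finset.sum_product]
          simp only [Finset.sum_const, Nat.card_Icc, add_tsub_cancel_right, nsmul_eq_mul]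
          congr 1
          rw [Finset.mul_sum, Finset.sum_product]
          refine Finset.sum_congr rfl fun q₁ _ => ?_
          rw [Finset.mul_sum]
          refine Finset.sum_congr rfl fun q₂ _ => ?_
          ring
        rw [hz]
        ring
    _ ≤ Tn * Tr * K * (H : ℝ) ^ 2 * ((Q : ℝ) ^ 2 + 2 * H * ∑ q ∈ Finset.Icc 1 Q, ((#q.divisors : ℕ) : ℝ)) := by
        refine mul_le_mul_of_nonneg_left (sum_linePairs_bound_le Q H) ?_
        positivity

/-! ### The bound for one smoothed block from Lemma 1 -/

/-- `‖B‖` over one dyadic block `r ∼ 2^l/2`, `l ≤ L`, is at most `‖B‖` over the box `[1,N] × [1,2^L]`.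
[folklore] -/
theorem lemma1Norm_block_le (Nmax : ℕ) {l L : ℕ} (hl : l ≤ L) (Bc : ℕ × ℕ → ℂ) :
    lemma1Norm Nmax ((2 : ℝ) ^ l / 2) (1 / 2) (fun n r _ => Bc (n, r)) ≤
      Real.sqrt (∑ y ∈ Finset.Icc 1 Nmax ×ˢ Finset.Icc 1 (2 ^ L), ‖Bc y‖ ^ 2) := by
  unfold lemma1Norm
  refine Real.sqrt_le_sqrt ?_
  rw [dyadic_half]
  simp only [Finset.sum_singleton]
  rw [Finset.sum_product, Finset.sum_comm]
  exact Finset.sum_le_sum fun n _ =>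
    Finset.sum_le_sum_of_subset_of_nonneg (dyadic_pow_half_subset hl) fun _ _ _ => by positivity

/-- `∑_{c ≤ cM} ∑_{d ≤ dM} g(c,d) ≤ cM dM` for the block weight `0 ≤ g ≤ 1`. [folklore] -/
theorem sum_sum_plateau2_le (C' D' : ℝ) (cM dM : ℕ) :
    ∑ c ∈ Finset.Icc 1 cM, ∑ d ∈ Finset.Icc 1 dM, plateau2 (c / C') (d / D') ≤ (cM : ℝ) * dM := by
  calc ∑ c ∈ Finset.Icc 1 cM, ∑ d ∈ Finset.Icc 1 dM, plateau2 (c / C') (d / D')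
      ≤ ∑ c ∈ Finset.Icc 1 cM, ∑ d ∈ Finset.Icc 1 dM, (1 : ℝ) :=
        Finset.sum_le_sum fun c _ => Finset.sum_le_sum fun d _ => plateau2_le_one _ _
    _ = (cM : ℝ) * dM := by
        simp only [Finset.sum_const, Nat.card_Icc, add_tsub_cancel_right, nsmul_eq_mul, mul_one]

/-- **One smoothed block, from Lemma 1** (BFI p. 227): for the weight `g(c,d) = w(c/C')w(d/D')`,
`blockA ≤ ♯T₀ · (5C'/4)(5D'/4) + 2 ∑_{l ≤ L} K₁ (C'D'N R_l S)^ε 𝓘(C',D',N,R_l,S) ‖B‖_box`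
with `N = AKHQ`, `R_l = 2^l/2`, `S = 1/2`, `2^L ≥ Q²`, where `K₁ ≥ 0` is the constant of Lemma 1
for the weight `w ⊗ w` at the exponent `ε`. [cite: BombieriFriedlanderIwaniecActa1986, §8 p. 227] -/
theorem blockA_le_of_K1 {ε K₁ : ℝ} (hK₁0 : 0 ≤ K₁)
    (hK₁ : ∀ C' D' N R S : ℝ, 1 ≤ C' → 1 ≤ D' → 1 ≤ N → 1 / 2 ≤ R → 1 / 2 ≤ S →
      ∀ B : ℕ → ℕ → ℕ → ℂ,
        ‖dispK (fun c d => plateau2 (c / C') (d / D')) ⌊5 / 4 * C'⌋₊ ⌊5 / 4 * D'⌋₊ ⌊N⌋₊ R S B‖ ≤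
          K₁ * (C' * D' * N * R * S) ^ ε * lemma1I C' D' N R S * lemma1Norm ⌊N⌋₊ R S B)
    {A K H Q : ℕ} (hA : 1 ≤ A) (hK : 1 ≤ K) (hH : 1 ≤ H) (hQ : 1 ≤ Q)
    {C' D' : ℝ} (hC' : 1 ≤ C') (hD' : 1 ≤ D') {α : ℕ → ℕ → ℂ} (hα : ∀ h q, ‖α h q‖ ≤ 1)
    {L : ℕ} (hL : Q * Q ≤ 2 ^ L) :
    blockA (A : ℤ) (fun c d => plateau2 (c / C') (d / D')) ⌊5 / 4 * C'⌋₊ ⌊5 / 4 * D'⌋₊ K H Q α ≤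
      #(tsetZero K H Q) * ((⌊5 / 4 * C'⌋₊ : ℝ) * ⌊5 / 4 * D'⌋₊) +
        2 * ∑ l ∈ Finset.range (L + 1),
          K₁ * (C' * D' * ((A * K * (H * Q) : ℕ) : ℝ) * ((2 : ℝ) ^ l / 2) * (1 / 2)) ^ ε *
            lemma1I C' D' ((A * K * (H * Q) : ℕ) : ℝ) ((2 : ℝ) ^ l / 2) (1 / 2) *
            Real.sqrt (∑ y ∈ Finset.Icc 1 (A * K * (H * Q)) ×ˢ Finset.Icc 1 (2 ^ L),
              ‖Bcoef A α K H Q y‖ ^ 2) := by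
  set g : ℕ → ℕ → ℝ := fun c d => plateau2 (c / C') (d / D') with hg
  have hg0 : ∀ c d, 0 ≤ g c d := fun c d => plateau2_nonneg _ _
  set cM : ℕ := ⌊5 / 4 * C'⌋₊
  set dM : ℕ := ⌊5 / 4 * D'⌋₊
  set Nmax : ℕ := A * K * (H * Q) with hNmax
  have hN1 : (1 : ℝ) ≤ (Nmax : ℝ) := by
    have : 1 ≤ Nmax := by
      have h1 : 1 * 1 ≤ A * K := Nat.mul_le_mul hA hK
      have h2 : 1 * 1 ≤ H * Q := Nat.mul_le_mul hH hQ
      have h3 : 1 * 1 ≤ (A * K) * (H * Q) := Nat.mul_le_mul (by simpa using h1) (by simpa using h2)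
      simpa [hNmax] using h3
    exact_mod_cast this
  -- the two parts
  have hparts := blockA_le_parts (A : ℤ) g cM dM K H Q α
  have hZ0 := norm_Zpart_zero_le (A : ℤ) hg0 cM dM K H Q hα
  have hG : ∑ c ∈ Finset.Icc 1 cM, ∑ d ∈ Finset.Icc 1 dM, g c d ≤ (cM : ℝ) * dM :=
    sum_sum_plateau2_le C' D' cM dM
  have hZpos : ‖Zpart (tsetPos K H Q) (A : ℤ) g cM dM α‖ ≤
      ∑ l ∈ Finset.range (L + 1),
        K₁ * (C' * D' * (Nmax : ℝ) * ((2 : ℝ) ^ l / 2) * (1 / 2)) ^ ε *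
          lemma1I C' D' (Nmax : ℝ) ((2 : ℝ) ^ l / 2) (1 / 2) *
          Real.sqrt (∑ y ∈ Finset.Icc 1 Nmax ×ˢ Finset.Icc 1 (2 ^ L), ‖Bcoef A α K H Q y‖ ^ 2) := by
    rw [Zpart_pos_eq_sum_dispK hA g cM dM K H Q α hL]
    refine (norm_sum_le _ _).trans (Finset.sum_le_sum fun l hl => ?_)
    have hlL : l ≤ L := Nat.lt_succ_iff.1 (Finset.mem_range.1 hl)
    have hR : (1 : ℝ) / 2 ≤ (2 : ℝ) ^ l / 2 := by
      have : (1 : ℝ) ≤ (2 : ℝ) ^ l := one_le_pow₀ (by norm_num)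
      linarith
    have h := hK₁ C' D' (Nmax : ℝ) ((2 : ℝ) ^ l / 2) (1 / 2) hC' hD' hN1 hR le_rfl
      (fun n r _ => Bcoef A α K H Q (n, r))
    rw [Nat.floor_natCast] at h
    refine h.trans ?_
    refine mul_le_mul_of_nonneg_left (lemma1Norm_block_le Nmax hlL _) ?_
    have : 0 ≤ lemma1I C' D' (Nmax : ℝ) ((2 : ℝ) ^ l / 2) (1 / 2) := Real.sqrt_nonneg _
    positivity
  calc blockA (A : ℤ) g cM dM K H Q α
      ≤ ‖Zpart (tsetZero K H Q) (A : ℤ) g cM dM α‖ + 2 * ‖Zpart (tsetPos K H Q) (A : ℤ) g cM dM α‖ := hparts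
    _ ≤ #(tsetZero K H Q) * ((cM : ℝ) * dM) + 2 * ∑ l ∈ Finset.range (L + 1),
          K₁ * (C' * D' * (Nmax : ℝ) * ((2 : ℝ) ^ l / 2) * (1 / 2)) ^ ε *
            lemma1I C' D' (Nmax : ℝ) ((2 : ℝ) ^ l / 2) (1 / 2) *
            Real.sqrt (∑ y ∈ Finset.Icc 1 Nmax ×ˢ Finset.Icc 1 (2 ^ L), ‖Bcoef A α K H Q y‖ ^ 2) := by
        have h1 : ‖Zpart (tsetZero K H Q) (A : ℤ) g cM dM α‖ ≤ #(tsetZero K H Q) * ((cM : ℝ) * dM) :=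
          hZ0.trans (mul_le_mul_of_nonneg_left hG (Nat.cast_nonneg _))
        linarith

/-! ### Covering `[1, C] × [1, D]` by smoothed dyadic blocks -/

/-- For `f ≥ 0` vanishing beyond `M`, `∑_{c ≤ N} f(c) ≤ ∑_{c ≤ M} f(c)`. [folklore] -/
theorem sum_Icc_le_sum_Icc_of_vanish {f : ℕ → ℝ} {N M : ℕ} (hf : ∀ c, 0 ≤ f c)
    (hvan : ∀ c, M < c → f c = 0) :
    ∑ c ∈ Finset.Icc 1 N, f c ≤ ∑ c ∈ Finset.Icc 1 M, f c := by
  rw [← Finset.sum_filter_ne_zero (Finset.Icc 1 N)]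
  refine Finset.sum_le_sum_of_subset_of_nonneg (fun c hc => ?_) fun c _ _ => hf c
  rw [Finset.mem_filter, Finset.mem_Icc] at hc
  rw [Finset.mem_Icc]
  refine ⟨hc.1.1, ?_⟩
  by_contra h
  exact hc.2 (hvan c (not_le.1 h))

/-- **The plateaus at the scales `2^i`, `i ≤ log₂ C₀ + 1`, cover `[1, C₀]`**: for `1 ≤ c ≤ C₀`,
`1 ≤ ∑_{i ≤ I} w(c/2^i)` with `I = ⌊log₂ C₀⌋ + 1` (the term `i = ⌈log₂ c⌉` equals `1`). [folklore] -/
theorem one_le_sum_plateau {C₀ c : ℕ} (hc1 : 1 ≤ c) (hcC : c ≤ C₀) :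
    (1 : ℝ) ≤ ∑ i ∈ Finset.range (Nat.log 2 C₀ + 1 + 1), plateau1 ((c : ℝ) / (2 : ℝ) ^ i) := by
  set i₀ := Nat.clog 2 c with hi₀
  have hle : c ≤ 2 ^ i₀ := Nat.le_pow_clog one_lt_two c
  have hlt : 2 ^ i₀ < 2 * c := by
    rcases Nat.lt_or_ge 1 c with h1 | h1
    · have hpos : 0 < i₀ := Nat.clog_pos one_lt_two h1
      have h := Nat.pow_pred_clog_lt_self one_lt_two h1
      rw [← hi₀] at h
      have : 2 ^ i₀ = 2 * 2 ^ (i₀.pred) := by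
        rw [← pow_succ']
        congr 1
        exact (Nat.succ_pred_eq_of_pos hpos).symm
      rw [this]
      omega
    · have hc : c = 1 := le_antisymm h1 hc1
      rw [hi₀, hc, Nat.clog_one_right]
      norm_num
  have hI : i₀ ∈ Finset.range (Nat.log 2 C₀ + 1 + 1) := by
    rw [Finset.mem_range, Nat.lt_succ_iff]
    have hC : c ≤ 2 ^ (Nat.log 2 C₀ + 1) := (hcC.trans (Nat.lt_pow_succ_log_self one_lt_two C₀).le)
    calc i₀ = Nat.clog 2 c := hi₀
      _ ≤ Nat.clog 2 (2 ^ (Nat.log 2 C₀ + 1)) := Nat.clog_mono_right 2 hC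
      _ = Nat.log 2 C₀ + 1 := Nat.clog_pow 2 _ one_lt_two
  have hone : plateau1 ((c : ℝ) / (2 : ℝ) ^ i₀) = 1 := by
    have hpow : (0 : ℝ) < (2 : ℝ) ^ i₀ := by positivity
    have hle' : (c : ℝ) ≤ (2 : ℝ) ^ i₀ := by exact_mod_cast hle
    have hlt' : (2 : ℝ) ^ i₀ < 2 * c := by exact_mod_cast hlt
    refine plateau_eq_one ?_ ?_
    · rw [le_div_iff₀ hpow]; linarith
    · rw [div_le_one hpow]; exact hle'
  calc (1 : ℝ) = plateau1 ((c : ℝ) / (2 : ℝ) ^ i₀) := hone.symm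
    _ ≤ ∑ i ∈ Finset.range (Nat.log 2 C₀ + 1 + 1), plateau1 ((c : ℝ) / (2 : ℝ) ^ i) :=
        Finset.single_le_sum (f := fun i => plateau1 ((c : ℝ) / (2 : ℝ) ^ i))
          (fun i _ => plateau_nonneg _) hI

/-- `𝒜` with natural-number parameters `H, Q` inside. [folklore] -/
theorem dispA_eq_sum_innerAk (a : ℤ) (C D K H Q : ℝ) (α : ℕ → ℕ → ℂ) :
    dispA a C D K H Q α = ∑ c ∈ Finset.Icc 1 ⌊C⌋₊, ∑ d ∈ Finset.Icc 1 ⌊D⌋₊,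
      ∑ k ∈ Finset.Icc 1 ⌊K⌋₊, ‖innerAk a ⌊H⌋₊ ((⌊Q⌋₊ : ℕ) : ℝ) α c d k‖ ^ 2 := by
  unfold dispA innerAk
  simp only [Nat.floor_natCast]

/-- **`𝒜 ≤ ∑_{i ≤ I} ∑_{j ≤ J} blockA_{ij}`**: the sharp cut-offs `c ≤ C`, `d ≤ D` are majorised by
the sum of the smooth dyadic plateaus (all terms of `𝒜` being `≥ 0`), BFI p. 227: "Clearly, it
suffices to prove (8.4) for a modified sum having the variables c, d reduced by a smooth weight
function g(c, d)". [cite: BombieriFriedlanderIwaniecActa1986, §8 p. 227] -/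
theorem dispA_le_sum_blockA (a : ℤ) (C D K H Q : ℝ) (α : ℕ → ℕ → ℂ) :
    dispA a C D K H Q α ≤
      ∑ i ∈ Finset.range (Nat.log 2 ⌊C⌋₊ + 1 + 1), ∑ j ∈ Finset.range (Nat.log 2 ⌊D⌋₊ + 1 + 1),
        blockA a (fun c d => plateau2 (c / (2 : ℝ) ^ i) (d / (2 : ℝ) ^ j))
          ⌊5 / 4 * (2 : ℝ) ^ i⌋₊ ⌊5 / 4 * (2 : ℝ) ^ j⌋₊ ⌊K⌋₊ ⌊H⌋₊ ⌊Q⌋₊ α := by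
  rw [dispA_eq_sum_innerAk]
  set C₀ := ⌊C⌋₊
  set D₀ := ⌊D⌋₊
  set X : ℕ → ℕ → ℝ := fun c d => ∑ k ∈ Finset.Icc 1 ⌊K⌋₊, ‖innerAk a ⌊H⌋₊ ((⌊Q⌋₊ : ℕ) : ℝ) α c d k‖ ^ 2
    with hX
  have hX0 : ∀ c d, 0 ≤ X c d := fun c d => Finset.sum_nonneg fun _ _ => by positivity
  set SI := Finset.range (Nat.log 2 C₀ + 1 + 1)
  set SJ := Finset.range (Nat.log 2 D₀ + 1 + 1)
  -- step 1: insert the covering weights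
  have h1 : ∑ c ∈ Finset.Icc 1 C₀, ∑ d ∈ Finset.Icc 1 D₀, X c d ≤
      ∑ c ∈ Finset.Icc 1 C₀, ∑ d ∈ Finset.Icc 1 D₀,
        (∑ i ∈ SI, plateau1 ((c : ℝ) / (2 : ℝ) ^ i)) * (∑ j ∈ SJ, plateau1 ((d : ℝ) / (2 : ℝ) ^ j)) * X c d := by
    refine Finset.sum_le_sum fun c hc => Finset.sum_le_sum fun d hd => ?_
    rw [Finset.mem_Icc] at hc hd
    have hc1 := one_le_sum_plateau hc.1 hc.2
    have hd1 := one_le_sum_plateau hd.1 hd.2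
    have : (1 : ℝ) ≤ (∑ i ∈ SI, plateau1 ((c : ℝ) / (2 : ℝ) ^ i)) * (∑ j ∈ SJ, plateau1 ((d : ℝ) / (2 : ℝ) ^ j)) :=
      one_le_mul_of_one_le_of_one_le hc1 hd1
    exact le_mul_of_one_le_left (hX0 c d) this
  -- step 2: expand and reorder
  have h2 : ∑ c ∈ Finset.Icc 1 C₀, ∑ d ∈ Finset.Icc 1 D₀,
      (∑ i ∈ SI, plateau1 ((c : ℝ) / (2 : ℝ) ^ i)) * (∑ j ∈ SJ, plateau1 ((d : ℝ) / (2 : ℝ) ^ j)) * X c d =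
      ∑ i ∈ SI, ∑ j ∈ SJ, ∑ c ∈ Finset.Icc 1 C₀, ∑ d ∈ Finset.Icc 1 D₀,
        plateau1 ((c : ℝ) / (2 : ℝ) ^ i) * plateau1 ((d : ℝ) / (2 : ℝ) ^ j) * X c d := by
    simp_rw [Finset.sum_mul_sum, Finset.sum_mul]
    simp_rw [Finset.sum_comm (s := Finset.Icc 1 D₀) (t := SI)]
    rw [Finset.sum_comm (s := Finset.Icc 1 C₀) (t := SI)]
    simp_rw [Finset.sum_comm (s := Finset.Icc 1 D₀) (t := SJ)]
    simp_rw [Finset.sum_comm (s := Finset.Icc 1 C₀) (t := SJ)]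
  -- step 3: each `(i, j)`-term is at most `blockA_{ij}`
  have h3 : ∀ i j : ℕ, ∑ c ∈ Finset.Icc 1 C₀, ∑ d ∈ Finset.Icc 1 D₀,
      plateau1 ((c : ℝ) / (2 : ℝ) ^ i) * plateau1 ((d : ℝ) / (2 : ℝ) ^ j) * X c d ≤
      blockA a (fun c d => plateau2 (c / (2 : ℝ) ^ i) (d / (2 : ℝ) ^ j))
        ⌊5 / 4 * (2 : ℝ) ^ i⌋₊ ⌊5 / 4 * (2 : ℝ) ^ j⌋₊ ⌊K⌋₊ ⌊H⌋₊ ⌊Q⌋₊ α := by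
    intro i j
    unfold blockA plateau2
    have hvan : ∀ (m e : ℕ), ⌊5 / 4 * (2 : ℝ) ^ e⌋₊ < m → plateau1 ((m : ℝ) / (2 : ℝ) ^ e) = 0 := by
      intro m e hm
      have hpow : (0 : ℝ) < (2 : ℝ) ^ e := by positivity
      refine plateau_eq_zero_of_ge ?_
      rw [le_div_iff₀ hpow]
      have := Nat.lt_of_floor_lt hm
      linarith
    calc ∑ c ∈ Finset.Icc 1 C₀, ∑ d ∈ Finset.Icc 1 D₀,
          plateau1 ((c : ℝ) / (2 : ℝ) ^ i) * plateau1 ((d : ℝ) / (2 : ℝ) ^ j) * X c d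
        ≤ ∑ c ∈ Finset.Icc 1 C₀, ∑ d ∈ Finset.Icc 1 ⌊5 / 4 * (2 : ℝ) ^ j⌋₊,
          plateau1 ((c : ℝ) / (2 : ℝ) ^ i) * plateau1 ((d : ℝ) / (2 : ℝ) ^ j) * X c d := by
          refine Finset.sum_le_sum fun c _ => ?_
          refine sum_Icc_le_sum_Icc_of_vanish (fun d => ?_) (fun d hd => ?_)
          · exact mul_nonneg (mul_nonneg (plateau_nonneg _) (plateau_nonneg _)) (hX0 c d)
          · rw [hvan d j hd, mul_zero, zero_mul]
      _ ≤ ∑ c ∈ Finset.Icc 1 ⌊5 / 4 * (2 : ℝ) ^ i⌋₊, ∑ d ∈ Finset.Icc 1 ⌊5 / 4 * (2 : ℝ) ^ j⌋₊,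
          plateau1 ((c : ℝ) / (2 : ℝ) ^ i) * plateau1 ((d : ℝ) / (2 : ℝ) ^ j) * X c d := by
          refine sum_Icc_le_sum_Icc_of_vanish (fun c => ?_) (fun c hc => ?_)
          · exact Finset.sum_nonneg fun d _ =>
              mul_nonneg (mul_nonneg (plateau_nonneg _) (plateau_nonneg _)) (hX0 c d)
          · refine Finset.sum_eq_zero fun d _ => ?_
            rw [hvan c i hc, zero_mul, zero_mul]
      _ = _ := rfl
  calc ∑ c ∈ Finset.Icc 1 C₀, ∑ d ∈ Finset.Icc 1 D₀, X c d
      ≤ _ := h1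
    _ = _ := h2
    _ ≤ _ := Finset.sum_le_sum fun i _ => Finset.sum_le_sum fun j _ => h3 i j

/-! ### Numerical bounds for the assembly -/

/-- The bracket of (8.4): `C(Q²+HKQ)(C+DQ²) + C²DQ√(Q²+HKQ) + D²HKQ³`. [cite: BombieriFriedlanderIwaniecActa1986, §8 (8.4) p. 227] -/
def bracket84 (C D H K Q : ℝ) : ℝ :=
  C * (Q ^ 2 + H * K * Q) * (C + D * Q ^ 2) + C ^ 2 * D * Q * (Q ^ 2 + H * K * Q) ^ (1 / 2 : ℝ) +
    D ^ 2 * H * K * Q ^ 3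

/-- The bracket of (8.4) is `≥ 0`. [folklore] -/
theorem bracket84_nonneg {C D H K Q : ℝ} (hC : 0 ≤ C) (hD : 0 ≤ D) (hH : 0 ≤ H) (hK : 0 ≤ K)
    (hQ : 0 ≤ Q) : 0 ≤ bracket84 C D H K Q := by
  unfold bracket84; positivity

/-- **`𝓘(C', D', N, R, 1/2)² ≤ 8A · bracket`** for `C' ≤ 2C`, `D' ≤ 2D`, `N ≤ AHKQ`, `R ≤ Q²`, `A ≥ 1`.
[cite: BombieriFriedlanderIwaniecActa1986, §8 p. 227] -/
theorem lemma1I_sq_le {A C D H K Q C' D' N R : ℝ} (hA : 1 ≤ A) (hC : 1 ≤ C) (hD : 1 ≤ D) (hH : 1 ≤ H)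
    (hK : 1 ≤ K) (hQ : 1 ≤ Q) (hC'0 : 0 ≤ C') (hC' : C' ≤ 2 * C) (hD'0 : 0 ≤ D') (hD' : D' ≤ 2 * D)
    (hN0 : 0 ≤ N) (hN : N ≤ A * H * K * Q) (hR0 : 0 ≤ R) (hR : R ≤ Q ^ 2) :
    C' * (1 / 2) * (R * (1 / 2) + N) * (C' + D' * R) +
        C' ^ 2 * D' * (1 / 2) * Real.sqrt ((R * (1 / 2) + N) * R) + D' ^ 2 * N * R / (1 / 2) ≤
      8 * A * bracket84 C D H K Q := by
  unfold bracket84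
  have hQ0 : 0 ≤ Q := by linarith
  have hmid : R * (1 / 2) + N ≤ A * (Q ^ 2 + H * K * Q) := by
    have : Q ^ 2 ≤ A * Q ^ 2 := le_mul_of_one_le_left (by positivity) hA
    nlinarith
  have hmid0 : 0 ≤ R * (1 / 2) + N := by positivity
  -- term 1
  have h1 : C' * (1 / 2) * (R * (1 / 2) + N) * (C' + D' * R) ≤
      2 * A * (C * (Q ^ 2 + H * K * Q) * (C + D * Q ^ 2)) := by
    have e1 : C' + D' * R ≤ 2 * (C + D * Q ^ 2) := by
      have : D' * R ≤ 2 * D * Q ^ 2 := mul_le_mul hD' hR hR0 (by linarith)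
      linarith
    calc C' * (1 / 2) * (R * (1 / 2) + N) * (C' + D' * R)
        ≤ (2 * C) * (1 / 2) * (A * (Q ^ 2 + H * K * Q)) * (2 * (C + D * Q ^ 2)) := by
          gcongr
      _ = 2 * A * (C * (Q ^ 2 + H * K * Q) * (C + D * Q ^ 2)) := by ring
  -- term 2
  have h2 : C' ^ 2 * D' * (1 / 2) * Real.sqrt ((R * (1 / 2) + N) * R) ≤
      4 * A * (C ^ 2 * D * Q * (Q ^ 2 + H * K * Q) ^ (1 / 2 : ℝ)) := by
    have e1 : Real.sqrt ((R * (1 / 2) + N) * R) ≤ A * Q * Real.sqrt (Q ^ 2 + H * K * Q) := by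
      have : (R * (1 / 2) + N) * R ≤ (A * Q * Real.sqrt (Q ^ 2 + H * K * Q)) ^ 2 := by
        rw [mul_pow, mul_pow, Real.sq_sqrt (by positivity)]
        have hA2 : A ≤ A ^ 2 := by nlinarith
        calc (R * (1 / 2) + N) * R ≤ (A * (Q ^ 2 + H * K * Q)) * Q ^ 2 :=
              mul_le_mul hmid hR hR0 (by positivity)
          _ ≤ (A ^ 2 * (Q ^ 2 + H * K * Q)) * Q ^ 2 := by gcongr
          _ = A ^ 2 * Q ^ 2 * (Q ^ 2 + H * K * Q) := by ring
      calc Real.sqrt ((R * (1 / 2) + N) * R) ≤ Real.sqrt ((A * Q * Real.sqrt (Q ^ 2 + H * K * Q)) ^ 2) :=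
            Real.sqrt_le_sqrt this
        _ = A * Q * Real.sqrt (Q ^ 2 + H * K * Q) := Real.sqrt_sq (by positivity)
    have e2 : C' ^ 2 ≤ (2 * C) ^ 2 := pow_le_pow_left₀ hC'0 hC' 2
    rw [← Real.sqrt_eq_rpow]
    calc C' ^ 2 * D' * (1 / 2) * Real.sqrt ((R * (1 / 2) + N) * R)
        ≤ (2 * C) ^ 2 * (2 * D) * (1 / 2) * (A * Q * Real.sqrt (Q ^ 2 + H * K * Q)) := by
          gcongr
      _ = 4 * A * (C ^ 2 * D * Q * Real.sqrt (Q ^ 2 + H * K * Q)) := by ring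
  -- term 3
  have h3 : D' ^ 2 * N * R / (1 / 2) ≤ 8 * A * (D ^ 2 * H * K * Q ^ 3) := by
    have e2 : D' ^ 2 ≤ (2 * D) ^ 2 := pow_le_pow_left₀ hD'0 hD' 2
    calc D' ^ 2 * N * R / (1 / 2) = 2 * (D' ^ 2 * N * R) := by ring
      _ ≤ 2 * ((2 * D) ^ 2 * (A * H * K * Q) * Q ^ 2) := by gcongr
      _ = 8 * A * (D ^ 2 * H * K * Q ^ 3) := by ring
  have hb1 : 0 ≤ C * (Q ^ 2 + H * K * Q) * (C + D * Q ^ 2) := by positivity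
  have hb2 : 0 ≤ C ^ 2 * D * Q * (Q ^ 2 + H * K * Q) ^ (1 / 2 : ℝ) := by positivity
  have hb3 : 0 ≤ D ^ 2 * H * K * Q ^ 3 := by positivity
  nlinarith

/-- `𝓘(C', D', N, R, 1/2) ≤ √(8A) · bracket^{1/2}`. [folklore] -/
theorem lemma1I_le {A C D H K Q C' D' N R : ℝ} (hA : 1 ≤ A) (hC : 1 ≤ C) (hD : 1 ≤ D) (hH : 1 ≤ H)
    (hK : 1 ≤ K) (hQ : 1 ≤ Q) (hC'0 : 0 ≤ C') (hC' : C' ≤ 2 * C) (hD'0 : 0 ≤ D') (hD' : D' ≤ 2 * D)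
    (hN0 : 0 ≤ N) (hN : N ≤ A * H * K * Q) (hR0 : 0 ≤ R) (hR : R ≤ Q ^ 2) :
    lemma1I C' D' N R (1 / 2) ≤ Real.sqrt (8 * A) * (bracket84 C D H K Q) ^ (1 / 2 : ℝ) := by
  unfold lemma1I
  rw [← Real.sqrt_eq_rpow, ← Real.sqrt_mul (by linarith)]
  exact Real.sqrt_le_sqrt (lemma1I_sq_le hA hC hD hH hK hQ hC'0 hC' hD'0 hD' hN0 hN hR0 hR)

/-- The `(CDNRS)^ε` factor: `(C'D'N R/2)^ε ≤ (2A)^ε P^{3ε}` with `P = CDHKQ`. [folklore] -/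
theorem eps_factor_le {A C D H K Q C' D' N R ε : ℝ} (hA : 1 ≤ A) (hC : 1 ≤ C) (hD : 1 ≤ D) (hH : 1 ≤ H)
    (hK : 1 ≤ K) (hQ : 1 ≤ Q) (hC'0 : 0 ≤ C') (hC' : C' ≤ 2 * C) (hD'0 : 0 ≤ D') (hD' : D' ≤ 2 * D)
    (hN0 : 0 ≤ N) (hN : N ≤ A * H * K * Q) (hR0 : 0 ≤ R) (hR : R ≤ Q ^ 2) (hε : 0 ≤ ε) :
    (C' * D' * N * R * (1 / 2)) ^ ε ≤ (2 * A) ^ ε * (C * D * H * K * Q) ^ (3 * ε) := by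
  set P := C * D * H * K * Q with hP
  have hP1 : 1 ≤ P := by
    have h1 : 1 ≤ C * D := one_le_mul_of_one_le_of_one_le hC hD
    have h2 : 1 ≤ C * D * H := one_le_mul_of_one_le_of_one_le h1 hH
    have h3 : 1 ≤ C * D * H * K := one_le_mul_of_one_le_of_one_le h2 hK
    exact one_le_mul_of_one_le_of_one_le h3 hQ
  have hQP : Q ≤ P := by
    have h1 : 1 ≤ C * D := one_le_mul_of_one_le_of_one_le hC hD
    have h2 : 1 ≤ C * D * H := one_le_mul_of_one_le_of_one_le h1 hH
    have h3 : 1 ≤ C * D * H * K := one_le_mul_of_one_le_of_one_le h2 hK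
    calc Q = 1 * Q := (one_mul Q).symm
      _ ≤ (C * D * H * K) * Q := mul_le_mul_of_nonneg_right h3 (by linarith)
  have hbase : C' * D' * N * R * (1 / 2) ≤ 2 * A * P ^ 3 := by
    calc C' * D' * N * R * (1 / 2) ≤ (2 * C) * (2 * D) * (A * H * K * Q) * Q ^ 2 * (1 / 2) := by
          gcongr
      _ = 2 * A * (P * Q ^ 2) := by rw [hP]; ring
      _ ≤ 2 * A * (P * P ^ 2) := by
          have : Q ^ 2 ≤ P ^ 2 := pow_le_pow_left₀ (by linarith) hQP 2
          have hP0 : 0 ≤ P := by linarith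
          exact mul_le_mul_of_nonneg_left (mul_le_mul_of_nonneg_left this hP0) (by linarith)
      _ = 2 * A * P ^ 3 := by ring
  calc (C' * D' * N * R * (1 / 2)) ^ ε ≤ (2 * A * P ^ 3) ^ ε :=
        Real.rpow_le_rpow (by positivity) hbase hε
    _ = (2 * A) ^ ε * (P ^ 3) ^ ε := Real.mul_rpow (by linarith) (by positivity)
    _ = (2 * A) ^ ε * P ^ (3 * ε) := by
        congr 1
        rw [show (P ^ 3 : ℝ) = P ^ ((3 : ℕ) : ℝ) by rw [Real.rpow_natCast], ← Real.rpow_mul (by linarith)]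
        norm_num

/-- **`log₂ n + 2 ≤ c_θ x^θ`** for `1 ≤ n ≤ x`: the number of dyadic blocks is `≪ x^θ`. [folklore] -/
theorem natLog_two_add_two_le {n : ℕ} {x θ : ℝ} (hn : 1 ≤ n) (hnx : (n : ℝ) ≤ x) (hθ : 0 < θ) :
    ((Nat.log 2 n : ℕ) : ℝ) + 2 ≤ (1 / (θ * Real.log 2) + 2) * x ^ θ := by
  have hx1 : 1 ≤ x := le_trans (by exact_mod_cast hn) hnx
  have hlog2 : 0 < Real.log 2 := Real.log_pos one_lt_two
  -- `2^{log₂ n} ≤ n`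
  have h1 : ((2 ^ Nat.log 2 n : ℕ) : ℝ) ≤ n := by
    exact_mod_cast Nat.pow_log_le_self 2 (by omega : n ≠ 0)
  have h2 : (Nat.log 2 n : ℝ) * Real.log 2 ≤ Real.log x := by
    have : Real.log ((2 : ℝ) ^ (Nat.log 2 n)) ≤ Real.log x := by
      refine Real.log_le_log (by positivity) ?_
      push_cast at h1
      linarith
    rwa [Real.log_pow] at this
  have h3 : Real.log x ≤ x ^ θ / θ := Real.log_le_rpow_div (by linarith) hθ
  have hxθ : 1 ≤ x ^ θ := Real.one_le_rpow hx1 hθ.le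
  have h4 : (Nat.log 2 n : ℝ) ≤ x ^ θ / (θ * Real.log 2) := by
    rw [le_div_iff₀ (by positivity)]
    calc (Nat.log 2 n : ℝ) * (θ * Real.log 2) = θ * ((Nat.log 2 n : ℝ) * Real.log 2) := by ring
      _ ≤ θ * Real.log x := mul_le_mul_of_nonneg_left h2 hθ.le
      _ ≤ θ * (x ^ θ / θ) := mul_le_mul_of_nonneg_left h3 hθ.le
      _ = x ^ θ := by field_simp
  calc ((Nat.log 2 n : ℕ) : ℝ) + 2 ≤ x ^ θ / (θ * Real.log 2) + 2 * x ^ θ := by linarith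
    _ = (1 / (θ * Real.log 2) + 2) * x ^ θ := by ring

/-- `1 ≤ P = CDHKQ` and `X ≤ P` for each factor. [folklore] -/
theorem one_le_P {C D H K Q : ℝ} (hC : 1 ≤ C) (hD : 1 ≤ D) (hH : 1 ≤ H) (hK : 1 ≤ K) (hQ : 1 ≤ Q) :
    1 ≤ C * D * H * K * Q ∧ C ≤ C * D * H * K * Q ∧ D ≤ C * D * H * K * Q ∧
      H * K * Q ≤ C * D * H * K * Q ∧ Q ≤ C * D * H * K * Q := by
  have h1 : 1 ≤ C * D := one_le_mul_of_one_le_of_one_le hC hD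
  have h2 : 1 ≤ C * D * H := one_le_mul_of_one_le_of_one_le h1 hH
  have h3 : 1 ≤ C * D * H * K := one_le_mul_of_one_le_of_one_le h2 hK
  have h4 : 1 ≤ C * D * H * K * Q := one_le_mul_of_one_le_of_one_le h3 hQ
  have h5 : 1 ≤ H * K := one_le_mul_of_one_le_of_one_le hH hK
  have h6 : 1 ≤ H * K * Q := one_le_mul_of_one_le_of_one_le h5 hQ
  have h7 : 1 ≤ D * H * K * Q := by nlinarith
  have h8 : 1 ≤ C * H * K * Q := by nlinarith
  refine ⟨h4, ?_, ?_, ?_, ?_⟩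
  · calc C = C * 1 := (mul_one C).symm
      _ ≤ C * (D * H * K * Q) := mul_le_mul_of_nonneg_left h7 (by linarith)
      _ = C * D * H * K * Q := by ring
  · calc D = D * 1 := (mul_one D).symm
      _ ≤ D * (C * H * K * Q) := mul_le_mul_of_nonneg_left h8 (by linarith)
      _ = C * D * H * K * Q := by ring
  · calc H * K * Q = 1 * (H * K * Q) := (one_mul _).symm
      _ ≤ (C * D) * (H * K * Q) := mul_le_mul_of_nonneg_right h1 (by linarith)
      _ = C * D * H * K * Q := by ring
  · calc Q = 1 * Q := (one_mul Q).symm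
      _ ≤ (C * D * H * K) * Q := mul_le_mul_of_nonneg_right h3 (by linarith)

/-- `∑_{q ≤ Q₀} τ(q) ≤ C_δ Q^{1+δ}` from the divisor bound. [folklore] -/
theorem sum_divisors_le {Cδ δ : ℝ} (hCδ : 0 ≤ Cδ) (hδ : 0 ≤ δ)
    (hτ : ∀ n : ℕ, (#n.divisors : ℝ) ≤ Cδ * (n : ℝ) ^ δ) {Q₀ : ℕ} {Q : ℝ} (hQ₀ : (Q₀ : ℝ) ≤ Q) :
    ∑ q ∈ Finset.Icc 1 Q₀, ((#q.divisors : ℕ) : ℝ) ≤ Cδ * Q * Q ^ δ := by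
  have hQ0 : 0 ≤ Q := le_trans (Nat.cast_nonneg _) hQ₀
  calc ∑ q ∈ Finset.Icc 1 Q₀, ((#q.divisors : ℕ) : ℝ) ≤ ∑ q ∈ Finset.Icc 1 Q₀, Cδ * Q ^ δ := by
        refine Finset.sum_le_sum fun q hq => (hτ q).trans ?_
        refine mul_le_mul_of_nonneg_left (Real.rpow_le_rpow (Nat.cast_nonneg _) ?_ hδ) hCδ
        exact le_trans (by exact_mod_cast (Finset.mem_Icc.1 hq).2) hQ₀
    _ = Q₀ * (Cδ * Q ^ δ) := by
        rw [Finset.sum_const, Nat.card_Icc, add_tsub_cancel_right, nsmul_eq_mul]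
    _ ≤ Q * (Cδ * Q ^ δ) := mul_le_mul_of_nonneg_right hQ₀ (by positivity)
    _ = Cδ * Q * Q ^ δ := by ring

/-- **The box sum of `|B(n,r)|²`** in terms of `P = CDHKQ`:
`∑ |B|² ≤ 2C_δ³ (2A)^δ P^{4δ} · K H² Q (Q + H)`. [cite: BombieriFriedlanderIwaniecActa1986, §8 p. 227] -/
theorem boxsum_le {A K₀ H₀ Q₀ : ℕ} (hA : 1 ≤ A) {α : ℕ → ℕ → ℂ} (hα : ∀ h q, ‖α h q‖ ≤ 1)
    {Cδ δ : ℝ} (hCδ : 1 ≤ Cδ) (hδ : 0 ≤ δ) (hτ : ∀ n : ℕ, (#n.divisors : ℝ) ≤ Cδ * (n : ℝ) ^ δ)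
    {C D H K Q : ℝ} (hC : 1 ≤ C) (hD : 1 ≤ D) (hH : 1 ≤ H) (hK : 1 ≤ K) (hQ : 1 ≤ Q)
    (hK₀ : (K₀ : ℝ) ≤ K) (hH₀ : (H₀ : ℝ) ≤ H) (hQ₀ : (Q₀ : ℝ) ≤ Q) {L : ℕ}
    (h2L : ((2 ^ L : ℕ) : ℝ) ≤ 2 * Q ^ 2) :
    ∑ y ∈ Finset.Icc 1 (A * K₀ * (H₀ * Q₀)) ×ˢ Finset.Icc 1 (2 ^ L), ‖Bcoef A α K₀ H₀ Q₀ y‖ ^ 2 ≤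
      2 * Cδ ^ 3 * (2 * A) ^ δ * (C * D * H * K * Q) ^ (4 * δ) * (K * H ^ 2 * (Q * (Q + H))) := by
  obtain ⟨hP1, _, _, hHKQP, hQP⟩ := one_le_P hC hD hH hK hQ
  set P := C * D * H * K * Q with hP
  have hP0 : 0 < P := by linarith
  have hA' : (1 : ℝ) ≤ A := by exact_mod_cast hA
  have hK0 : (0 : ℝ) ≤ K₀ := Nat.cast_nonneg _
  have hH0 : (0 : ℝ) ≤ H₀ := Nat.cast_nonneg _
  have hQ0 : (0 : ℝ) ≤ Q₀ := Nat.cast_nonneg _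
  set Tn : ℝ := Cδ * ((A : ℝ) * H * K * Q) ^ δ with hTn
  set Tr : ℝ := Cδ * (2 * Q ^ 2) ^ δ with hTr
  have hNmax : ((A * K₀ * (H₀ * Q₀) : ℕ) : ℝ) ≤ (A : ℝ) * H * K * Q := by
    push_cast
    calc (A : ℝ) * K₀ * (H₀ * Q₀) ≤ (A : ℝ) * K * (H * Q) := by gcongr
      _ = (A : ℝ) * H * K * Q := by ring
  have hTn_hyp : ∀ y ∈ Finset.Icc 1 (A * K₀ * (H₀ * Q₀)) ×ˢ Finset.Icc 1 (2 ^ L),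
      (#y.1.divisors : ℝ) ≤ Tn := by
    intro y hy
    rw [Finset.mem_product, Finset.mem_Icc] at hy
    refine (hτ y.1).trans (mul_le_mul_of_nonneg_left (Real.rpow_le_rpow (Nat.cast_nonneg _) ?_ hδ)
      (by linarith))
    exact le_trans (by exact_mod_cast hy.1.2) hNmax
  have hTr_hyp : ∀ y ∈ Finset.Icc 1 (A * K₀ * (H₀ * Q₀)) ×ˢ Finset.Icc 1 (2 ^ L),
      (#y.2.divisors : ℝ) ≤ Tr := by
    intro y hy
    rw [Finset.mem_product, Finset.mem_Icc, Finset.mem_Icc] at hy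
    refine (hτ y.2).trans (mul_le_mul_of_nonneg_left (Real.rpow_le_rpow (Nat.cast_nonneg _) ?_ hδ)
      (by linarith))
    exact le_trans (by exact_mod_cast hy.2.2) h2L
  have hY : ∀ y ∈ Finset.Icc 1 (A * K₀ * (H₀ * Q₀)) ×ˢ Finset.Icc 1 (2 ^ L), y.1 ≠ 0 ∧ y.2 ≠ 0 := by
    intro y hy
    rw [Finset.mem_product, Finset.mem_Icc, Finset.mem_Icc] at hy
    exact ⟨by omega, by omega⟩
  have h := sum_norm_sq_Bcoef_le (K := K₀) (H := H₀) (Q := Q₀) hA hα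
    (Finset.Icc 1 (A * K₀ * (H₀ * Q₀)) ×ˢ Finset.Icc 1 (2 ^ L))
    (Tn := Tn) (Tr := Tr) (by positivity) (by positivity) hTn_hyp hTr_hyp hY
  refine h.trans ?_
  have hsum := sum_divisors_le (by linarith : (0 : ℝ) ≤ Cδ) hδ hτ hQ₀
  -- `Tn Tr ≤ Cδ² (2A)^δ P^{3δ}`
  have hTT : Tn * Tr ≤ Cδ ^ 2 * (2 * A) ^ δ * P ^ (3 * δ) := by
    have e : Tn * Tr = Cδ ^ 2 * ((2 * A) * (H * K * Q * Q ^ 2)) ^ δ := by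
      rw [hTn, hTr]
      have h2 : ((2 : ℝ) * A * (H * K * Q * Q ^ 2)) ^ δ = ((A : ℝ) * H * K * Q) ^ δ * (2 * Q ^ 2) ^ δ := by
        rw [← Real.mul_rpow (by positivity) (by positivity)]
        congr 1
        ring
      rw [h2]
      ring
    rw [e, Real.mul_rpow (by positivity) (by positivity)]
    have hb : H * K * Q * Q ^ 2 ≤ P ^ (3 : ℕ) := by
      have : Q ^ 2 ≤ P ^ 2 := pow_le_pow_left₀ (by linarith) hQP 2
      calc H * K * Q * Q ^ 2 ≤ P * P ^ 2 := mul_le_mul hHKQP this (by positivity) hP0.le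
        _ = P ^ 3 := by ring
    have : (H * K * Q * Q ^ 2) ^ δ ≤ P ^ (3 * δ) := by
      calc (H * K * Q * Q ^ 2) ^ δ ≤ (P ^ (3 : ℕ)) ^ δ := Real.rpow_le_rpow (by positivity) hb hδ
        _ = P ^ (3 * δ) := by rw [← Real.rpow_natCast, ← Real.rpow_mul hP0.le]; norm_num
    have h0 : 0 ≤ Cδ ^ 2 * (2 * (A : ℝ)) ^ δ := by positivity
    calc Cδ ^ 2 * ((2 * (A : ℝ)) ^ δ * (H * K * Q * Q ^ 2) ^ δ)
        = Cδ ^ 2 * (2 * (A : ℝ)) ^ δ * (H * K * Q * Q ^ 2) ^ δ := by ring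
      _ ≤ Cδ ^ 2 * (2 * (A : ℝ)) ^ δ * P ^ (3 * δ) := mul_le_mul_of_nonneg_left this h0
  -- the second factor
  have hQδ1 : 1 ≤ Q ^ δ := Real.one_le_rpow hQ hδ
  have hQδP : Q ^ δ ≤ P ^ δ := Real.rpow_le_rpow (by linarith) hQP hδ
  have hs0 : 0 ≤ ∑ q ∈ Finset.Icc 1 Q₀, ((#q.divisors : ℕ) : ℝ) := Finset.sum_nonneg fun _ _ => Nat.cast_nonneg _
  have hsecond : (K₀ : ℝ) * (H₀ : ℝ) ^ 2 * ((Q₀ : ℝ) ^ 2 + 2 * H₀ * ∑ q ∈ Finset.Icc 1 Q₀, ((#q.divisors : ℕ) : ℝ)) ≤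
      K * H ^ 2 * (2 * Cδ * P ^ δ * (Q * (Q + H))) := by
    have e1 : (Q₀ : ℝ) ^ 2 + 2 * H₀ * ∑ q ∈ Finset.Icc 1 Q₀, ((#q.divisors : ℕ) : ℝ) ≤
        Q ^ 2 + 2 * H * (Cδ * Q * Q ^ δ) := by
      have : (Q₀ : ℝ) ^ 2 ≤ Q ^ 2 := pow_le_pow_left₀ hQ0 hQ₀ 2
      have h2 : (H₀ : ℝ) * ∑ q ∈ Finset.Icc 1 Q₀, ((#q.divisors : ℕ) : ℝ) ≤ H * (Cδ * Q * Q ^ δ) :=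
        mul_le_mul hH₀ hsum hs0 (by linarith)
      linarith
    have e2 : Q ^ 2 + 2 * H * (Cδ * Q * Q ^ δ) ≤ 2 * Cδ * P ^ δ * (Q * (Q + H)) := by
      have hQ2 : Q ^ 2 ≤ Cδ * P ^ δ * Q ^ 2 := by
        have : 1 ≤ Cδ * P ^ δ := one_le_mul_of_one_le_of_one_le hCδ (hQδ1.trans hQδP)
        nlinarith
      have hHQ : 2 * H * (Cδ * Q * Q ^ δ) ≤ 2 * Cδ * P ^ δ * (Q * H) := by
        have : 2 * H * (Cδ * Q * Q ^ δ) = 2 * Cδ * Q ^ δ * (Q * H) := by ring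
        rw [this]
        gcongr
      nlinarith
    calc (K₀ : ℝ) * (H₀ : ℝ) ^ 2 * ((Q₀ : ℝ) ^ 2 + 2 * H₀ * ∑ q ∈ Finset.Icc 1 Q₀, ((#q.divisors : ℕ) : ℝ))
        ≤ K * H ^ 2 * (Q ^ 2 + 2 * H * (Cδ * Q * Q ^ δ)) := by
          have hH2 : (H₀ : ℝ) ^ 2 ≤ H ^ 2 := pow_le_pow_left₀ hH0 hH₀ 2
          have hin0 : 0 ≤ (Q₀ : ℝ) ^ 2 + 2 * H₀ * ∑ q ∈ Finset.Icc 1 Q₀, ((#q.divisors : ℕ) : ℝ) :=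
            add_nonneg (sq_nonneg _) (mul_nonneg (mul_nonneg zero_le_two hH0) hs0)
          exact mul_le_mul (mul_le_mul hK₀ hH2 (by positivity) (by linarith)) e1 hin0 (by positivity)
      _ ≤ K * H ^ 2 * (2 * Cδ * P ^ δ * (Q * (Q + H))) :=
          mul_le_mul_of_nonneg_left e2 (by positivity)
  have h4δ : P ^ (3 * δ) * P ^ δ = P ^ (4 * δ) := by rw [← Real.rpow_add hP0]; ring_nf
  have hin0 : 0 ≤ (K₀ : ℝ) * (H₀ : ℝ) ^ 2 * ((Q₀ : ℝ) ^ 2 + 2 * H₀ * ∑ q ∈ Finset.Icc 1 Q₀, ((#q.divisors : ℕ) : ℝ)) :=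
    mul_nonneg (mul_nonneg hK0 (pow_nonneg hH0 2))
      (add_nonneg (sq_nonneg _) (mul_nonneg (mul_nonneg zero_le_two hH0) hs0))
  calc Tn * Tr * (K₀ : ℝ) * (H₀ : ℝ) ^ 2 * ((Q₀ : ℝ) ^ 2 + 2 * H₀ * ∑ q ∈ Finset.Icc 1 Q₀, ((#q.divisors : ℕ) : ℝ))
      = (Tn * Tr) * ((K₀ : ℝ) * (H₀ : ℝ) ^ 2 * ((Q₀ : ℝ) ^ 2 + 2 * H₀ * ∑ q ∈ Finset.Icc 1 Q₀, ((#q.divisors : ℕ) : ℝ))) := by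
        ring
    _ ≤ (Cδ ^ 2 * (2 * A) ^ δ * P ^ (3 * δ)) * (K * H ^ 2 * (2 * Cδ * P ^ δ * (Q * (Q + H)))) :=
        mul_le_mul hTT hsecond hin0 (by positivity)
    _ = 2 * Cδ ^ 3 * (2 * A) ^ δ * (P ^ (3 * δ) * P ^ δ) * (K * H ^ 2 * (Q * (Q + H))) := by ring
    _ = 2 * Cδ ^ 3 * (2 * A) ^ δ * P ^ (4 * δ) * (K * H ^ 2 * (Q * (Q + H))) := by rw [h4δ]

/-- `√(box sum) ≤ √(2C_δ³(2A)^δ) · P^{2δ} · H √(KQ) √(H+Q)`. [folklore] -/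
theorem sqrt_boxsum_le {A K₀ H₀ Q₀ : ℕ} (hA : 1 ≤ A) {α : ℕ → ℕ → ℂ} (hα : ∀ h q, ‖α h q‖ ≤ 1)
    {Cδ δ : ℝ} (hCδ : 1 ≤ Cδ) (hδ : 0 ≤ δ) (hτ : ∀ n : ℕ, (#n.divisors : ℝ) ≤ Cδ * (n : ℝ) ^ δ)
    {C D H K Q : ℝ} (hC : 1 ≤ C) (hD : 1 ≤ D) (hH : 1 ≤ H) (hK : 1 ≤ K) (hQ : 1 ≤ Q)
    (hK₀ : (K₀ : ℝ) ≤ K) (hH₀ : (H₀ : ℝ) ≤ H) (hQ₀ : (Q₀ : ℝ) ≤ Q) {L : ℕ}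
    (h2L : ((2 ^ L : ℕ) : ℝ) ≤ 2 * Q ^ 2) :
    Real.sqrt (∑ y ∈ Finset.Icc 1 (A * K₀ * (H₀ * Q₀)) ×ˢ Finset.Icc 1 (2 ^ L), ‖Bcoef A α K₀ H₀ Q₀ y‖ ^ 2) ≤
      Real.sqrt (2 * Cδ ^ 3 * (2 * A) ^ δ) * (C * D * H * K * Q) ^ (2 * δ) *
        (H * Real.sqrt (K * Q) * Real.sqrt (H + Q)) := by
  have h := boxsum_le hA hα hCδ hδ hτ hC hD hH hK hQ hK₀ hH₀ hQ₀ h2L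
  obtain ⟨hP1, _⟩ := one_le_P hC hD hH hK hQ
  set P := C * D * H * K * Q with hP
  have hP0 : 0 < P := by linarith
  set T : ℝ := Real.sqrt (2 * Cδ ^ 3 * (2 * A) ^ δ) * P ^ (2 * δ) * (H * Real.sqrt (K * Q) * Real.sqrt (H + Q))
    with hT
  have hT0 : 0 ≤ T := by positivity
  have hT2 : T ^ 2 = 2 * Cδ ^ 3 * (2 * A) ^ δ * P ^ (4 * δ) * (K * H ^ 2 * (Q * (Q + H))) := by
    have e1 : (P ^ (2 * δ)) ^ 2 = P ^ (4 * δ) := by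
      rw [← Real.rpow_natCast, ← Real.rpow_mul hP0.le]; ring_nf
    calc T ^ 2 = (Real.sqrt (2 * Cδ ^ 3 * (2 * A) ^ δ)) ^ 2 * (P ^ (2 * δ)) ^ 2 *
        (H ^ 2 * (Real.sqrt (K * Q)) ^ 2 * (Real.sqrt (H + Q)) ^ 2) := by rw [hT]; ring
      _ = (2 * Cδ ^ 3 * (2 * A) ^ δ) * P ^ (4 * δ) * (H ^ 2 * (K * Q) * (H + Q)) := by
        rw [Real.sq_sqrt (by positivity), Real.sq_sqrt (by positivity), Real.sq_sqrt (by positivity), e1]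
      _ = _ := by ring
  calc Real.sqrt (∑ y ∈ Finset.Icc 1 (A * K₀ * (H₀ * Q₀)) ×ˢ Finset.Icc 1 (2 ^ L), ‖Bcoef A α K₀ H₀ Q₀ y‖ ^ 2)
      ≤ Real.sqrt (T ^ 2) := Real.sqrt_le_sqrt (h.trans (le_of_eq hT2.symm))
    _ = T := Real.sqrt_sq hT0

/-- **The diagonal term**: `♯T₀ · (5C'/4)(5D'/4) ≤ (25/2) C_δ · P · P^δ`. [cite: BombieriFriedlanderIwaniecActa1986, §8 p. 227] -/
theorem diag_term_le {K₀ H₀ Q₀ : ℕ} {Cδ δ : ℝ} (hCδ : 1 ≤ Cδ) (hδ : 0 ≤ δ)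
    (hτ : ∀ n : ℕ, (#n.divisors : ℝ) ≤ Cδ * (n : ℝ) ^ δ)
    {C D H K Q C' D' : ℝ} (hC : 1 ≤ C) (hD : 1 ≤ D) (hH : 1 ≤ H) (hK : 1 ≤ K) (hQ : 1 ≤ Q)
    (hK₀ : (K₀ : ℝ) ≤ K) (hH₀ : (H₀ : ℝ) ≤ H) (hQ₀ : (Q₀ : ℝ) ≤ Q)
    (hC'0 : 0 ≤ C') (hC' : C' ≤ 2 * C) (hD'0 : 0 ≤ D') (hD' : D' ≤ 2 * D) :
    (#(tsetZero K₀ H₀ Q₀) : ℝ) * ((⌊5 / 4 * C'⌋₊ : ℝ) * ⌊5 / 4 * D'⌋₊) ≤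
      25 / 2 * Cδ * (C * D * H * K * Q) * (C * D * H * K * Q) ^ δ := by
  obtain ⟨hP1, _, _, _, hQP⟩ := one_le_P hC hD hH hK hQ
  set P := C * D * H * K * Q with hP
  have hK0 : (0 : ℝ) ≤ K₀ := Nat.cast_nonneg _
  have hH0 : (0 : ℝ) ≤ H₀ := Nat.cast_nonneg _
  have hsum := sum_divisors_le (by linarith : (0 : ℝ) ≤ Cδ) hδ hτ hQ₀
  have hs0 : 0 ≤ ∑ q ∈ Finset.Icc 1 Q₀, ((#q.divisors : ℕ) : ℝ) := Finset.sum_nonneg fun _ _ => Nat.cast_nonneg _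
  have h1 : (#(tsetZero K₀ H₀ Q₀) : ℝ) ≤ K * (2 * H * (Cδ * Q * Q ^ δ)) := by
    rw [card_tsetZero]
    calc (K₀ : ℝ) * ∑ q₁ ∈ Finset.Icc 1 Q₀, ∑ q₂ ∈ Finset.Icc 1 Q₀, (#(diagPairs q₁ q₂ H₀) : ℝ)
        ≤ (K₀ : ℝ) * (2 * H₀ * ∑ q ∈ Finset.Icc 1 Q₀, ((#q.divisors : ℕ) : ℝ)) :=
          mul_le_mul_of_nonneg_left (sum_card_diagPairs_le Q₀ H₀) hK0
      _ ≤ K * (2 * H * (Cδ * Q * Q ^ δ)) := by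
          have h2 : (H₀ : ℝ) * ∑ q ∈ Finset.Icc 1 Q₀, ((#q.divisors : ℕ) : ℝ) ≤ H * (Cδ * Q * Q ^ δ) :=
            mul_le_mul hH₀ hsum hs0 (by linarith)
          have h3 : 0 ≤ 2 * (H₀ : ℝ) * ∑ q ∈ Finset.Icc 1 Q₀, ((#q.divisors : ℕ) : ℝ) :=
            mul_nonneg (mul_nonneg zero_le_two hH0) hs0
          refine mul_le_mul hK₀ ?_ h3 (by linarith)
          linarith
  have h2 : (⌊5 / 4 * C'⌋₊ : ℝ) * ⌊5 / 4 * D'⌋₊ ≤ (5 / 4 * (2 * C)) * (5 / 4 * (2 * D)) := by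
    have e1 : (⌊5 / 4 * C'⌋₊ : ℝ) ≤ 5 / 4 * (2 * C) := (Nat.floor_le (by positivity)).trans (by linarith)
    have e2 : (⌊5 / 4 * D'⌋₊ : ℝ) ≤ 5 / 4 * (2 * D) := (Nat.floor_le (by positivity)).trans (by linarith)
    exact mul_le_mul e1 e2 (Nat.cast_nonneg _) (by positivity)
  have hQδP : Q ^ δ ≤ P ^ δ := Real.rpow_le_rpow (by linarith) hQP hδ
  have hP0 : 0 ≤ P := by linarith
  calc (#(tsetZero K₀ H₀ Q₀) : ℝ) * ((⌊5 / 4 * C'⌋₊ : ℝ) * ⌊5 / 4 * D'⌋₊)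
      ≤ (K * (2 * H * (Cδ * Q * Q ^ δ))) * ((5 / 4 * (2 * C)) * (5 / 4 * (2 * D))) :=
        mul_le_mul h1 h2 (by positivity) (by positivity)
    _ = 25 / 2 * Cδ * P * Q ^ δ := by rw [hP]; ring
    _ ≤ 25 / 2 * Cδ * P * P ^ δ := mul_le_mul_of_nonneg_left hQδP (by positivity)

/-! ### Assembly: Lemma 6 for `a = A ≥ 1` -/

/-- The block scales `2^i`, `i ≤ log₂⌊C⌋ + 1`, are `≤ 2C`. [folklore] -/
theorem two_pow_le_of_mem_range {C : ℝ} (hC : 1 ≤ C) {i : ℕ}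
    (hi : i ∈ Finset.range (Nat.log 2 ⌊C⌋₊ + 1 + 1)) : (2 : ℝ) ^ i ≤ 2 * C := by
  have hC₀ : 1 ≤ ⌊C⌋₊ := Nat.le_floor (by exact_mod_cast hC)
  have hi' : i ≤ Nat.log 2 ⌊C⌋₊ + 1 := Nat.lt_succ_iff.1 (Finset.mem_range.1 hi)
  have h1 : 2 ^ i ≤ 2 * ⌊C⌋₊ := by
    calc 2 ^ i ≤ 2 ^ (Nat.log 2 ⌊C⌋₊ + 1) := Nat.pow_le_pow_right (by norm_num) hi'
      _ = 2 * 2 ^ Nat.log 2 ⌊C⌋₊ := by rw [pow_succ']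
      _ ≤ 2 * ⌊C⌋₊ := Nat.mul_le_mul_left 2 (Nat.pow_log_le_self 2 (by omega))
  have h2 : ((2 ^ i : ℕ) : ℝ) ≤ ((2 * ⌊C⌋₊ : ℕ) : ℝ) := by exact_mod_cast h1
  push_cast at h2
  have h3 : (⌊C⌋₊ : ℝ) ≤ C := Nat.floor_le (by linarith)
  linarith

set_option maxHeartbeats 1600000 in
-- the final assembly of Lemma 6 (long but elementary bookkeeping)
/-- **BFI Lemma 6 from Lemma 1, for `a = A ≥ 1`** (§8, (8.4), p. 227), in the shape
`𝒜 ≤ C₆ (CDHKQ)^η {CDHKQ + H(KQ)^{1/2}(H+Q)^{1/2} [bracket]^{1/2}}`.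
[cite: BombieriFriedlanderIwaniecActa1986, §8 Lemma 6 p. 227] -/
theorem dispA_le_pos (hLB : Lemma1BoundFor plateau2 (5 / 4)) {A : ℕ} (hA : 1 ≤ A) {η : ℝ} (hη : 0 < η) :
    ∃ C₆ : ℝ, ∀ C D K H Q : ℝ, 1 ≤ C → 1 ≤ D → 1 ≤ K → 1 ≤ H → 1 ≤ Q →
      ∀ α : ℕ → ℕ → ℂ, (∀ h q, ‖α h q‖ ≤ 1) →
        dispA (A : ℤ) C D K H Q α ≤
          C₆ * ((C * D * H * K * Q) ^ η * (C * D * H * K * Q +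
            H * (K * Q) ^ (1 / 2 : ℝ) * (H + Q) ^ (1 / 2 : ℝ) * (bracket84 C D H K Q) ^ (1 / 2 : ℝ))) := by
  -- constants
  set δ : ℝ := η / 10 with hδ
  have hδ0 : 0 < δ := by positivity
  obtain ⟨K', hK'⟩ := hLB δ hδ0
  set K₁ : ℝ := max K' 0 with hK₁
  have hK₁0 : 0 ≤ K₁ := le_max_right _ _
  have hK₁b : ∀ C' D' N R S : ℝ, 1 ≤ C' → 1 ≤ D' → 1 ≤ N → 1 / 2 ≤ R → 1 / 2 ≤ S →
      ∀ B : ℕ → ℕ → ℕ → ℂ,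
        ‖dispK (fun c d => plateau2 (c / C') (d / D')) ⌊5 / 4 * C'⌋₊ ⌊5 / 4 * D'⌋₊ ⌊N⌋₊ R S B‖ ≤
          K₁ * (C' * D' * N * R * S) ^ δ * lemma1I C' D' N R S * lemma1Norm ⌊N⌋₊ R S B := by
    intro C' D' N R S h1 h2 h3 h4 h5 B
    refine (hK' C' D' N R S h1 h2 h3 h4 h5 B).trans ?_
    have hx : 0 ≤ (C' * D' * N * R * S) ^ δ * lemma1I C' D' N R S * lemma1Norm ⌊N⌋₊ R S B := by
      have : 0 ≤ lemma1I C' D' N R S := Real.sqrt_nonneg _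
      have : 0 ≤ lemma1Norm ⌊N⌋₊ R S B := Real.sqrt_nonneg _
      have : 0 ≤ (C' * D' * N * R * S) ^ δ := Real.rpow_nonneg (by positivity) _
      positivity
    calc K' * (C' * D' * N * R * S) ^ δ * lemma1I C' D' N R S * lemma1Norm ⌊N⌋₊ R S B
        = K' * ((C' * D' * N * R * S) ^ δ * lemma1I C' D' N R S * lemma1Norm ⌊N⌋₊ R S B) := by ring
      _ ≤ K₁ * ((C' * D' * N * R * S) ^ δ * lemma1I C' D' N R S * lemma1Norm ⌊N⌋₊ R S B) :=
          mul_le_mul_of_nonneg_right (le_max_left _ _) hx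
      _ = _ := by ring
  obtain ⟨Cδ, hCδ1, hτ⟩ := exists_card_divisors_le_mul_rpow' hδ0
  have hlog2 : 0 < Real.log 2 := Real.log_pos one_lt_two
  set c₁ : ℝ := 1 / (δ * Real.log 2) + 2 with hc₁
  have hc₁0 : 0 ≤ c₁ := by positivity
  have hA' : (1 : ℝ) ≤ (A : ℝ) := by exact_mod_cast hA
  set V₀ : ℝ := K₁ * (2 * (A : ℝ)) ^ δ * Real.sqrt (8 * A) * Real.sqrt (2 * Cδ ^ 3 * (2 * A) ^ δ) with hV₀
  have hV₀0 : 0 ≤ V₀ := by positivity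
  refine ⟨c₁ ^ 2 * (25 / 2 * Cδ) + 2 * c₁ ^ 3 * V₀, ?_⟩
  intro C D K H Q hC hD hK hH hQ α hα
  obtain ⟨hP1, hCP, hDP, hHKQP, hQP⟩ := one_le_P hC hD hH hK hQ
  have hP0 : 0 < C * D * H * K * Q := by linarith
  -- the natural-number parameters
  have hK₀1 : 1 ≤ ⌊K⌋₊ := Nat.le_floor (by exact_mod_cast hK)
  have hH₀1 : 1 ≤ ⌊H⌋₊ := Nat.le_floor (by exact_mod_cast hH)
  have hQ₀1 : 1 ≤ ⌊Q⌋₊ := Nat.le_floor (by exact_mod_cast hQ)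
  have hC₀1 : 1 ≤ ⌊C⌋₊ := Nat.le_floor (by exact_mod_cast hC)
  have hD₀1 : 1 ≤ ⌊D⌋₊ := Nat.le_floor (by exact_mod_cast hD)
  have hK₀le : (⌊K⌋₊ : ℝ) ≤ K := Nat.floor_le (by linarith)
  have hH₀le : (⌊H⌋₊ : ℝ) ≤ H := Nat.floor_le (by linarith)
  have hQ₀le : (⌊Q⌋₊ : ℝ) ≤ Q := Nat.floor_le (by linarith)
  have hC₀le : (⌊C⌋₊ : ℝ) ≤ C := Nat.floor_le (by linarith)
  have hD₀le : (⌊D⌋₊ : ℝ) ≤ D := Nat.floor_le (by linarith)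
  set L := Nat.log 2 (⌊Q⌋₊ * ⌊Q⌋₊) + 1 with hL
  have hQQ1 : 1 ≤ ⌊Q⌋₊ * ⌊Q⌋₊ := by nlinarith
  have hQL : ⌊Q⌋₊ * ⌊Q⌋₊ ≤ 2 ^ L := (Nat.lt_pow_succ_log_self one_lt_two _).le
  have hQQle : ((⌊Q⌋₊ * ⌊Q⌋₊ : ℕ) : ℝ) ≤ Q ^ 2 := by
    push_cast
    nlinarith [Nat.cast_nonneg (α := ℝ) ⌊Q⌋₊]
  have h2L : ((2 ^ L : ℕ) : ℝ) ≤ 2 * Q ^ 2 := by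
    have h1 : 2 ^ L ≤ 2 * (⌊Q⌋₊ * ⌊Q⌋₊) := by
      rw [hL, pow_succ']
      exact Nat.mul_le_mul_left 2 (Nat.pow_log_le_self 2 (by omega))
    calc ((2 ^ L : ℕ) : ℝ) ≤ ((2 * (⌊Q⌋₊ * ⌊Q⌋₊) : ℕ) : ℝ) := by exact_mod_cast h1
      _ = 2 * ((⌊Q⌋₊ * ⌊Q⌋₊ : ℕ) : ℝ) := by push_cast; ring
      _ ≤ 2 * Q ^ 2 := by linarith
  -- abbreviations for the target pieces (genuine real numbers)
  have hW0 : 0 ≤ H * Real.sqrt (K * Q) * Real.sqrt (H + Q) := by positivity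
  have hBr0 : 0 ≤ (bracket84 C D H K Q) ^ (1 / 2 : ℝ) :=
    Real.rpow_nonneg (bracket84_nonneg (by linarith) (by linarith) (by linarith) (by linarith) (by linarith)) _
  have hPδ1 : 1 ≤ (C * D * H * K * Q) ^ δ := Real.one_le_rpow hP1 hδ0.le
  -- the uniform block bound
  have hblock : ∀ i ∈ Finset.range (Nat.log 2 ⌊C⌋₊ + 1 + 1), ∀ j ∈ Finset.range (Nat.log 2 ⌊D⌋₊ + 1 + 1),
      blockA (A : ℤ) (fun c d => plateau2 (c / (2 : ℝ) ^ i) (d / (2 : ℝ) ^ j))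
        ⌊5 / 4 * (2 : ℝ) ^ i⌋₊ ⌊5 / 4 * (2 : ℝ) ^ j⌋₊ ⌊K⌋₊ ⌊H⌋₊ ⌊Q⌋₊ α ≤
        25 / 2 * Cδ * (C * D * H * K * Q) * (C * D * H * K * Q) ^ δ +
          2 * (((L + 1 : ℕ) : ℝ) * (V₀ * ((C * D * H * K * Q) ^ (3 * δ) * (C * D * H * K * Q) ^ (2 * δ)) *
            (bracket84 C D H K Q) ^ (1 / 2 : ℝ) * (H * Real.sqrt (K * Q) * Real.sqrt (H + Q)))) := by
    intro i hi j hj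
    have hi' : (2 : ℝ) ^ i ≤ 2 * C := two_pow_le_of_mem_range hC hi
    have hj' : (2 : ℝ) ^ j ≤ 2 * D := two_pow_le_of_mem_range hD hj
    have h1i : (1 : ℝ) ≤ (2 : ℝ) ^ i := one_le_pow₀ (by norm_num)
    have h1j : (1 : ℝ) ≤ (2 : ℝ) ^ j := one_le_pow₀ (by norm_num)
    have hb := blockA_le_of_K1 hK₁0 hK₁b hA hK₀1 hH₀1 hQ₀1 h1i h1j hα hQL
    refine hb.trans (add_le_add ?_ (mul_le_mul_of_nonneg_left ?_ zero_le_two))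
    · exact diag_term_le hCδ1 hδ0.le hτ hC hD hH hK hQ hK₀le hH₀le hQ₀le (by positivity) hi'
        (by positivity) hj'
    · have hN : ((A * ⌊K⌋₊ * (⌊H⌋₊ * ⌊Q⌋₊) : ℕ) : ℝ) ≤ (A : ℝ) * H * K * Q := by
        push_cast
        calc (A : ℝ) * ⌊K⌋₊ * (⌊H⌋₊ * ⌊Q⌋₊) ≤ (A : ℝ) * K * (H * Q) := by gcongr
          _ = (A : ℝ) * H * K * Q := by ring
      have hl : ∀ l ∈ Finset.range (L + 1),
          K₁ * ((2 : ℝ) ^ i * (2 : ℝ) ^ j * ((A * ⌊K⌋₊ * (⌊H⌋₊ * ⌊Q⌋₊) : ℕ) : ℝ) * ((2 : ℝ) ^ l / 2) * (1 / 2)) ^ δ *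
            lemma1I ((2 : ℝ) ^ i) ((2 : ℝ) ^ j) ((A * ⌊K⌋₊ * (⌊H⌋₊ * ⌊Q⌋₊) : ℕ) : ℝ) ((2 : ℝ) ^ l / 2) (1 / 2) *
            Real.sqrt (∑ y ∈ Finset.Icc 1 (A * ⌊K⌋₊ * (⌊H⌋₊ * ⌊Q⌋₊)) ×ˢ Finset.Icc 1 (2 ^ L),
              ‖Bcoef A α ⌊K⌋₊ ⌊H⌋₊ ⌊Q⌋₊ y‖ ^ 2) ≤
          V₀ * ((C * D * H * K * Q) ^ (3 * δ) * (C * D * H * K * Q) ^ (2 * δ)) *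
            (bracket84 C D H K Q) ^ (1 / 2 : ℝ) * (H * Real.sqrt (K * Q) * Real.sqrt (H + Q)) := by
        intro l hl
        have hlL : l ≤ L := Nat.lt_succ_iff.1 (Finset.mem_range.1 hl)
        have hR : (2 : ℝ) ^ l / 2 ≤ Q ^ 2 := by
          have h1 : ((2 ^ l : ℕ) : ℝ) ≤ ((2 ^ L : ℕ) : ℝ) := by
            exact_mod_cast Nat.pow_le_pow_right (by norm_num) hlL
          push_cast at h1 h2L
          linarith
        have e1 := eps_factor_le hA' hC hD hH hK hQ (by positivity) hi' (by positivity) hj'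
          (Nat.cast_nonneg _) hN (by positivity) hR hδ0.le
        have e2 := lemma1I_le hA' hC hD hH hK hQ (by positivity) hi' (by positivity) hj'
          (Nat.cast_nonneg _) hN (by positivity) hR
        have e3 := sqrt_boxsum_le hA hα hCδ1 hδ0.le hτ hC hD hH hK hQ hK₀le hH₀le hQ₀le h2L
        have hI0 : 0 ≤ lemma1I ((2 : ℝ) ^ i) ((2 : ℝ) ^ j) ((A * ⌊K⌋₊ * (⌊H⌋₊ * ⌊Q⌋₊) : ℕ) : ℝ)
            ((2 : ℝ) ^ l / 2) (1 / 2) := Real.sqrt_nonneg _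
        calc K₁ * ((2 : ℝ) ^ i * (2 : ℝ) ^ j * ((A * ⌊K⌋₊ * (⌊H⌋₊ * ⌊Q⌋₊) : ℕ) : ℝ) * ((2 : ℝ) ^ l / 2) * (1 / 2)) ^ δ *
              lemma1I ((2 : ℝ) ^ i) ((2 : ℝ) ^ j) ((A * ⌊K⌋₊ * (⌊H⌋₊ * ⌊Q⌋₊) : ℕ) : ℝ) ((2 : ℝ) ^ l / 2) (1 / 2) *
              Real.sqrt (∑ y ∈ Finset.Icc 1 (A * ⌊K⌋₊ * (⌊H⌋₊ * ⌊Q⌋₊)) ×ˢ Finset.Icc 1 (2 ^ L),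
                ‖Bcoef A α ⌊K⌋₊ ⌊H⌋₊ ⌊Q⌋₊ y‖ ^ 2)
            ≤ K₁ * ((2 * (A : ℝ)) ^ δ * (C * D * H * K * Q) ^ (3 * δ)) *
              (Real.sqrt (8 * A) * (bracket84 C D H K Q) ^ (1 / 2 : ℝ)) *
              (Real.sqrt (2 * Cδ ^ 3 * (2 * A) ^ δ) * (C * D * H * K * Q) ^ (2 * δ) *
                (H * Real.sqrt (K * Q) * Real.sqrt (H + Q))) := by
              gcongr
          _ = V₀ * ((C * D * H * K * Q) ^ (3 * δ) * (C * D * H * K * Q) ^ (2 * δ)) *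
              (bracket84 C D H K Q) ^ (1 / 2 : ℝ) * (H * Real.sqrt (K * Q) * Real.sqrt (H + Q)) := by
              rw [hV₀]; ring
      calc ∑ l ∈ Finset.range (L + 1),
            K₁ * ((2 : ℝ) ^ i * (2 : ℝ) ^ j * ((A * ⌊K⌋₊ * (⌊H⌋₊ * ⌊Q⌋₊) : ℕ) : ℝ) * ((2 : ℝ) ^ l / 2) * (1 / 2)) ^ δ *
              lemma1I ((2 : ℝ) ^ i) ((2 : ℝ) ^ j) ((A * ⌊K⌋₊ * (⌊H⌋₊ * ⌊Q⌋₊) : ℕ) : ℝ) ((2 : ℝ) ^ l / 2) (1 / 2) *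
              Real.sqrt (∑ y ∈ Finset.Icc 1 (A * ⌊K⌋₊ * (⌊H⌋₊ * ⌊Q⌋₊)) ×ˢ Finset.Icc 1 (2 ^ L),
                ‖Bcoef A α ⌊K⌋₊ ⌊H⌋₊ ⌊Q⌋₊ y‖ ^ 2)
          ≤ ∑ l ∈ Finset.range (L + 1),
              V₀ * ((C * D * H * K * Q) ^ (3 * δ) * (C * D * H * K * Q) ^ (2 * δ)) *
                (bracket84 C D H K Q) ^ (1 / 2 : ℝ) * (H * Real.sqrt (K * Q) * Real.sqrt (H + Q)) :=
            Finset.sum_le_sum hl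
        _ = _ := by rw [Finset.sum_const, Finset.card_range, nsmul_eq_mul]
  -- sum over the blocks
  have hA1 := dispA_le_sum_blockA (A : ℤ) C D K H Q α
  set U : ℝ := 25 / 2 * Cδ * (C * D * H * K * Q) * (C * D * H * K * Q) ^ δ +
    2 * (((L + 1 : ℕ) : ℝ) * (V₀ * ((C * D * H * K * Q) ^ (3 * δ) * (C * D * H * K * Q) ^ (2 * δ)) *
      (bracket84 C D H K Q) ^ (1 / 2 : ℝ) * (H * Real.sqrt (K * Q) * Real.sqrt (H + Q)))) with hU
  have hA2 : dispA (A : ℤ) C D K H Q α ≤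
      ((Nat.log 2 ⌊C⌋₊ + 1 + 1 : ℕ) : ℝ) * (((Nat.log 2 ⌊D⌋₊ + 1 + 1 : ℕ) : ℝ) * U) := by
    refine hA1.trans ?_
    calc ∑ i ∈ Finset.range (Nat.log 2 ⌊C⌋₊ + 1 + 1), ∑ j ∈ Finset.range (Nat.log 2 ⌊D⌋₊ + 1 + 1),
          blockA (A : ℤ) (fun c d => plateau2 (c / (2 : ℝ) ^ i) (d / (2 : ℝ) ^ j))
            ⌊5 / 4 * (2 : ℝ) ^ i⌋₊ ⌊5 / 4 * (2 : ℝ) ^ j⌋₊ ⌊K⌋₊ ⌊H⌋₊ ⌊Q⌋₊ α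
        ≤ ∑ i ∈ Finset.range (Nat.log 2 ⌊C⌋₊ + 1 + 1), ∑ j ∈ Finset.range (Nat.log 2 ⌊D⌋₊ + 1 + 1), U :=
          Finset.sum_le_sum fun i hi => Finset.sum_le_sum fun j hj => hblock i hi j hj
      _ = _ := by
          rw [Finset.sum_const, Finset.card_range, nsmul_eq_mul, Finset.sum_const, Finset.card_range,
            nsmul_eq_mul]
  -- the counting factors
  have hcC : ((Nat.log 2 ⌊C⌋₊ + 1 + 1 : ℕ) : ℝ) ≤ c₁ * (C * D * H * K * Q) ^ δ := by
    have h := natLog_two_add_two_le hC₀1 hC₀le hδ0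
    push_cast at h ⊢
    refine (by linarith : (Nat.log 2 ⌊C⌋₊ : ℝ) + 1 + 1 ≤ (1 / (δ * Real.log 2) + 2) * C ^ δ).trans ?_
    exact mul_le_mul_of_nonneg_left (Real.rpow_le_rpow (by linarith) hCP hδ0.le) hc₁0
  have hcD : ((Nat.log 2 ⌊D⌋₊ + 1 + 1 : ℕ) : ℝ) ≤ c₁ * (C * D * H * K * Q) ^ δ := by
    have h := natLog_two_add_two_le hD₀1 hD₀le hδ0
    push_cast at h ⊢
    refine (by linarith : (Nat.log 2 ⌊D⌋₊ : ℝ) + 1 + 1 ≤ (1 / (δ * Real.log 2) + 2) * D ^ δ).trans ?_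
    exact mul_le_mul_of_nonneg_left (Real.rpow_le_rpow (by linarith) hDP hδ0.le) hc₁0
  have hcL : ((L + 1 : ℕ) : ℝ) ≤ c₁ * (C * D * H * K * Q) ^ (2 * δ) := by
    have h := natLog_two_add_two_le (x := Q ^ 2) hQQ1 hQQle hδ0
    rw [hL]
    push_cast at h ⊢
    refine (by linarith : (Nat.log 2 (⌊Q⌋₊ * ⌊Q⌋₊) : ℝ) + 1 + 1 ≤ (1 / (δ * Real.log 2) + 2) * (Q ^ 2) ^ δ).trans ?_
    have e : (Q ^ 2) ^ δ = Q ^ (2 * δ) := by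
      rw [← Real.rpow_natCast, ← Real.rpow_mul (by linarith)]; norm_num
    rw [e]
    exact mul_le_mul_of_nonneg_left (Real.rpow_le_rpow (by linarith) hQP (by positivity)) hc₁0
  -- powers of `p = P^δ`
  set p : ℝ := (C * D * H * K * Q) ^ δ with hp
  have hp1 : 1 ≤ p := hPδ1
  have hp2 : (C * D * H * K * Q) ^ (2 * δ) = p ^ 2 := by
    rw [hp, ← Real.rpow_natCast, ← Real.rpow_mul hP0.le]; ring_nf
  have hp3 : (C * D * H * K * Q) ^ (3 * δ) = p ^ 3 := by
    rw [hp, ← Real.rpow_natCast, ← Real.rpow_mul hP0.le]; ring_nf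
  have hpη : (C * D * H * K * Q) ^ η = p ^ 10 := by
    rw [hp, ← Real.rpow_natCast, ← Real.rpow_mul hP0.le, hδ]; ring_nf
  rw [hp2, hp3] at hU
  rw [hp2] at hcL
  -- final algebra
  set P := C * D * H * K * Q with hPdef
  set W := H * Real.sqrt (K * Q) * Real.sqrt (H + Q) with hWdef
  set Br := (bracket84 C D H K Q) ^ (1 / 2 : ℝ) with hBrdef
  have hWrpow : H * (K * Q) ^ (1 / 2 : ℝ) * (H + Q) ^ (1 / 2 : ℝ) = W := by
    rw [hWdef, Real.sqrt_eq_rpow, Real.sqrt_eq_rpow]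
  rw [hWrpow, hpη]
  have hP0' : 0 ≤ P := hP0.le
  have hLp : ((L + 1 : ℕ) : ℝ) ≤ c₁ * p ^ 2 := hcL
  -- `U ≤ (25/2)Cδ P p + 2 c₁ p² V₀ p³ p² Br W`
  have hU1 : U ≤ 25 / 2 * Cδ * P * p + 2 * (c₁ * p ^ 2 * (V₀ * (p ^ 3 * p ^ 2) * Br * W)) := by
    rw [hU]
    have hx : 0 ≤ V₀ * (p ^ 3 * p ^ 2) * Br * W := by positivity
    nlinarith [mul_le_mul_of_nonneg_right hLp hx]
  have hU0 : 0 ≤ U := by rw [hU]; positivity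
  -- `dispA ≤ (c₁ p)(c₁ p) U`
  have hA3 : dispA (A : ℤ) C D K H Q α ≤ (c₁ * p) * ((c₁ * p) * U) := by
    refine hA2.trans ?_
    have h2 : ((Nat.log 2 ⌊D⌋₊ + 1 + 1 : ℕ) : ℝ) * U ≤ (c₁ * p) * U := mul_le_mul_of_nonneg_right hcD hU0
    calc ((Nat.log 2 ⌊C⌋₊ + 1 + 1 : ℕ) : ℝ) * (((Nat.log 2 ⌊D⌋₊ + 1 + 1 : ℕ) : ℝ) * U)
        ≤ ((Nat.log 2 ⌊C⌋₊ + 1 + 1 : ℕ) : ℝ) * ((c₁ * p) * U) :=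
          mul_le_mul_of_nonneg_left h2 (Nat.cast_nonneg _)
      _ ≤ (c₁ * p) * ((c₁ * p) * U) := mul_le_mul_of_nonneg_right hcC (by positivity)
  refine hA3.trans ?_
  -- polynomial bookkeeping in `p ≥ 1`
  have hp0 : 0 ≤ p := by linarith
  have hp3le : p ^ 3 ≤ p ^ 10 := pow_le_pow_right₀ hp1 (by norm_num)
  have hp9le : p ^ 9 ≤ p ^ 10 := pow_le_pow_right₀ hp1 (by norm_num)
  have hCδ0 : 0 ≤ Cδ := by linarith
  have hBW : 0 ≤ Br * W := mul_nonneg hBr0 hW0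
  calc (c₁ * p) * ((c₁ * p) * U)
      ≤ (c₁ * p) * ((c₁ * p) * (25 / 2 * Cδ * P * p + 2 * (c₁ * p ^ 2 * (V₀ * (p ^ 3 * p ^ 2) * Br * W)))) := by
        gcongr
    _ = c₁ ^ 2 * (25 / 2 * Cδ) * (p ^ 3 * P) + 2 * c₁ ^ 3 * V₀ * (p ^ 9 * (Br * W)) := by ring
    _ ≤ c₁ ^ 2 * (25 / 2 * Cδ) * (p ^ 10 * P) + 2 * c₁ ^ 3 * V₀ * (p ^ 10 * (Br * W)) := by
        gcongr
    _ ≤ (c₁ ^ 2 * (25 / 2 * Cδ) + 2 * c₁ ^ 3 * V₀) * (p ^ 10 * P) +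
          (c₁ ^ 2 * (25 / 2 * Cδ) + 2 * c₁ ^ 3 * V₀) * (p ^ 10 * (Br * W)) := by
        have h1 : 0 ≤ 2 * c₁ ^ 3 * V₀ * (p ^ 10 * P) := by positivity
        have h2 : 0 ≤ c₁ ^ 2 * (25 / 2 * Cδ) * (p ^ 10 * (Br * W)) := by positivity
        nlinarith
    _ = (c₁ ^ 2 * (25 / 2 * Cδ) + 2 * c₁ ^ 3 * V₀) * (p ^ 10 * (P + W * Br)) := by ring

/-! ### The sign of `a`, and Lemma 6 in the shape used by `BombieriFriedlanderIwaniecTheorem5_of_lemma6` -/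

/-- `e((−a)x̄·hk/c) = conj e((a x̄)·hk/c)` (the residues `((−a)x mod c)` and `((a)x mod c)` add up to
`0 mod c`). [folklore] -/
theorem e_val_neg {c : ℕ} (hc : 0 < c) (a : ℤ) (x : ZMod c) (h k : ℕ) :
    (𝐞 ((((((-a : ℤ) : ZMod c) * x).val : ℕ) : ℝ) * h * k / c) : ℂ) =
      conj ((𝐞 (((((a : ZMod c) * x).val : ℕ) : ℝ) * h * k / c) : ℂ)) := by
  haveI : NeZero c := ⟨hc.ne'⟩
  have hd : (c : ℤ) ∣ (((((-a : ℤ) : ZMod c) * x).val : ℕ) : ℤ) + ((((a : ZMod c) * x).val : ℕ) : ℤ) := by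
    rw [← ZMod.intCast_zmod_eq_zero_iff_dvd]
    push_cast
    rw [ZMod.natCast_zmod_val, ZMod.natCast_zmod_val]
    ring
  obtain ⟨m, hm⟩ := hd
  have hc0 : (0 : ℝ) < c := by exact_mod_cast hc
  have hreal : (((((-a : ℤ) : ZMod c) * x).val : ℕ) : ℝ) * h * k / c =
      -((((((a : ZMod c) * x).val : ℕ) : ℝ) * h * k / c)) + ((m * h * k : ℤ) : ℝ) := by
    have := congrArg (fun z : ℤ => (z : ℝ)) hm
    push_cast at this ⊢
    field_simp
    linear_combination (h : ℝ) * k * this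
  rw [hreal, e_add_intCast, e_neg_eq_conj]

/-- **`𝒜(−a; α) = 𝒜(a; conj α)`**: Lemma 6 for `a < 0` follows from the case `a > 0`. [folklore] -/
theorem dispA_neg (a : ℤ) (C D K H Q : ℝ) (α : ℕ → ℕ → ℂ) :
    dispA (-a) C D K H Q α = dispA a C D K H Q (fun h q => conj (α h q)) := by
  unfold dispA
  refine Finset.sum_congr rfl fun c hc => Finset.sum_congr rfl fun d _ => Finset.sum_congr rfl fun k _ => ?_
  have hc0 : 0 < c := (Finset.mem_Icc.1 hc).1
  rw [← Complex.norm_conj]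
  congr 2
  simp only [map_sum, map_mul]
  refine Finset.sum_congr rfl fun h _ => Finset.sum_congr rfl fun q _ => ?_
  rw [e_val_neg hc0, Complex.conj_conj]

/-- **BFI 1986, Lemma 6 (§8, (8.4), p. 227) from Lemma 1**, in exactly the shape consumed by
`BombieriFriedlanderIwaniecTheorem5_of_lemma6`: "Let `C, D, H, K, Q ≥ 1`, `a ≠ 0` and `ε > 0`. We
then have `𝒜(C,D,K,H,Q) ≪ (CDHKQ)^ε {CDHKQ + H(KQ)^{1/2}(H+Q)^{1/2}
[C(Q²+HKQ)(C+DQ²) + C²DQ√(Q²+HKQ) + D²HKQ³]^{1/2}}`, the constant implied in `≪` depending on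
`ε` and `a` only."  PROVED from the bound of Lemma 1 for the weight `w ⊗ w` (hypothesis
`BFI.Lemma1BoundFor BFI.plateau2 (5/4)`), following the printed proof: smooth majorant, squaring
out, the diagonal `n = 0`, Lemma 1 for `n ≠ 0` (by dyadic blocks in `r = q₁q₂`), and the count
for `‖B‖²`. [cite: BombieriFriedlanderIwaniecActa1986, §8 Lemma 6 p. 227] -/
theorem dispA_le_of_lemma1 (hLB : Lemma1BoundFor plateau2 (5 / 4)) :
    ∀ a : ℤ, a ≠ 0 → ∀ η : ℝ, 0 < η → ∃ C₆ : ℝ, ∀ C D K H Q : ℝ,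
      1 ≤ C → 1 ≤ D → 1 ≤ K → 1 ≤ H → 1 ≤ Q → ∀ α : ℕ → ℕ → ℂ, (∀ h q, ‖α h q‖ ≤ 1) →
        dispA a C D K H Q α ≤ C₆ * ((C * D * H * K * Q) ^ η *
          (C * D * H * K * Q + H * (K * Q) ^ (1 / 2 : ℝ) * (H + Q) ^ (1 / 2 : ℝ) *
            (C * (Q ^ 2 + H * K * Q) * (C + D * Q ^ 2) +
              C ^ 2 * D * Q * (Q ^ 2 + H * K * Q) ^ (1 / 2 : ℝ) +
                D ^ 2 * H * K * Q ^ 3) ^ (1 / 2 : ℝ))) := by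
  intro a ha η hη
  have hA : 1 ≤ a.natAbs := Int.natAbs_pos.2 ha
  obtain ⟨C₆, hC₆⟩ := dispA_le_pos hLB hA hη
  refine ⟨C₆, fun C D K H Q hC hD hK hH hQ α hα => ?_⟩
  rcases le_or_gt 0 a with h0 | h0
  · have e : a = (a.natAbs : ℤ) := (Int.natAbs_of_nonneg h0).symm
    rw [e]
    exact hC₆ C D K H Q hC hD hK hH hQ α hα
  · have e : a = -(a.natAbs : ℤ) := by
      rw [Int.ofNat_natAbs_of_nonpos h0.le]; ring
    rw [e, dispA_neg]
    refine hC₆ C D K H Q hC hD hK hH hQ (fun h q => conj (α h q)) fun h q => ?_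
    rw [Complex.norm_conj]
    exact hα h q

end L6

/-! ### Theorem 5, Theorem 5* and Theorem 5* on boxes from Lemma 1 -/

end BFI

open BFI

/-- **BFI 1986, Theorem 5 (§12, p. 237) from Lemma 1** — i.e. from the Deshouillers–Iwaniec
bound for sums of Kloosterman sums in the form printed as BFI's Lemma 1 (§2, p. 210), here for the
fixed smooth weight `g₀ = w ⊗ w` (`BFI.plateau2`, supported in `[1/4, 5/4]²`) and the ranges
`C, D, N ≥ 1`, `R, S ≥ 1/2` (hypothesis `BFI.Lemma1BoundFor BFI.plateau2 (5/4)`).  PROVED: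
Lemma 6 from Lemma 1 (`BFI.L6.dispA_le_of_lemma1`, this file), Lemma 9 and Theorem 5 from
Lemma 6 (`BombieriFriedlanderIwaniecTheorem5_of_lemma6`, `…Theorem5Reciprocity`, and §12 in
`…Theorem5Weights/Poisson/Reduction/Assembly`).  What remains unproved in the tree is exactly
Lemma 1 = Deshouillers–Iwaniec, Invent. Math. 70 (1982), Theorem 12.
[cite: BombieriFriedlanderIwaniecActa1986, §12 Theorem 5 p. 237; §2 Lemma 1 p. 210] -/
theorem BombieriFriedlanderIwaniecTheorem5_of_lemma1 (hLB : BFI.Lemma1BoundFor BFI.plateau2 (5 / 4)) :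
    BombieriFriedlanderIwaniecTheorem5 :=
  BombieriFriedlanderIwaniecTheorem5_of_lemma6 (BFI.L6.dispA_le_of_lemma1 hLB)

/-- **Theorem 5 from Lemma 1 quantified over all smooth weights** (the printed form of Lemma 1:
"Let `g₀(ξ, η)` be a smooth function with compact support in `ℝ⁺ × ℝ⁺` … the constant implied in
`≪` depending at most on `ε` and `g(ξ, η)`"; compact support in `ℝ⁺ × ℝ⁺` is rendered as
support in a box `[a, b]²`, `0 < a ≤ b`). [cite: BombieriFriedlanderIwaniecActa1986, §2 Lemma 1 p. 210] -/
theorem BombieriFriedlanderIwaniecTheorem5_of_lemma1'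
    (h1 : ∀ g₀ : ℝ → ℝ → ℝ, ContDiff ℝ ∞ (fun p : ℝ × ℝ => g₀ p.1 p.2) →
      ∀ a b : ℝ, 0 < a → a ≤ b →
        (∀ ξ η : ℝ, ¬ (ξ ∈ Set.Icc a b ∧ η ∈ Set.Icc a b) → g₀ ξ η = 0) →
          BFI.Lemma1BoundFor g₀ b) :
    BombieriFriedlanderIwaniecTheorem5 :=
  BombieriFriedlanderIwaniecTheorem5_of_lemma1
    (h1 BFI.plateau2 BFI.contDiff_plateau2 (1 / 4) (5 / 4) (by norm_num) (by norm_num)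
      fun _ _ h => BFI.plateau2_eq_zero h)

/-- **Theorem 5* on boxes (the named fact `BombieriFriedlanderIwaniecTheorem5StarInterval`) from
Lemma 1**, through `BombieriFriedlanderIwaniecTheorem5StarInterval_of_theorem5`.
[cite: BombieriFriedlanderIwaniecActa1986, §12 Theorem 5* p. 238, §15 p. 246] -/
theorem BombieriFriedlanderIwaniecTheorem5StarInterval_of_lemma1
    (hLB : BFI.Lemma1BoundFor BFI.plateau2 (5 / 4)) : BombieriFriedlanderIwaniecTheorem5StarInterval :=
  BombieriFriedlanderIwaniecTheorem5StarInterval_of_theorem5 (BombieriFriedlanderIwaniecTheorem5_of_lemma1 hLB)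

/-- **Theorem 5* as printed (the named fact `BombieriFriedlanderIwaniecTheorem5Star`) from Lemma 1.**
[cite: BombieriFriedlanderIwaniecActa1986, §12 Theorem 5* p. 238] -/
theorem BombieriFriedlanderIwaniecTheorem5Star_of_lemma1
    (hLB : BFI.Lemma1BoundFor BFI.plateau2 (5 / 4)) : BombieriFriedlanderIwaniecTheorem5Star :=
  BombieriFriedlanderIwaniecTheorem5Star_of_theorem5 (BombieriFriedlanderIwaniecTheorem5_of_lemma1 hLB)


end Literature.NumberTheory.Sieve
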